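import Summits.RiemannHypothesis.RiemannHypothesis.Theorems.TiltedLandingLaw421R3Lens1ArcSignM

/-!
# TiltedLandingLaw421R3 — lens-1 (part N): the NODAL LINK — one nodal path from the pole `a` pays the law directly

LENS-1 gen-8 module image `rh33346-cover/lens-1/PoleLink-v1.lean` (landing target `…/Theorems/TiltedLandingLaw421R3Lens1ArcSignN.lean`; ONE import =
part M `…R3Lens1ArcSignM`, for its Cauchy–Riemann monotonicity lemma; checked BY CHAIN `lens-1/PoleLink-v1-chain.lean` = the J ⊕ K ⊕ L ⊕ M chain ⊕ this
part over the tree parts A–I + `…R3NestedSign`).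

WHY (a second, much shorter ladder; SUMMON (O8-2)/(O8-4)).  Parts J–M price the ATOMIC class (30 % of the bank tops, C6 g39 J-census 351 / 1163) down to
the TONGUE SEAL, a per-gap, per-radius path statement that yields GAP ORDER ⇒ NET ⇒ RUNG 4 ⇒ the law.  The same harmonic-function picture contains a far
more economical certificate, valid for EVERY cluster size: with `G = f^{(j)}` and `φ = G′/G`, follow the nodal set `{Im φ = 0}` out of the pole `a`
keeping the positive face `{Im φ > 0}` on one fixed side.  Along such a path `Re φ` is MONOTONE (part M, Cauchy–Riemann + the one-sided sign) and it
starts at `∓∞` (simple pole of `φ` at `a`); so as soon as the path reaches a point where `Re φ` has the other sign — in particular as soon as it reaches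
ANOTHER ZERO `v` of `G` (where `Re φ → ±∞`) — it has passed a point with `φ = 0`, i.e. a zero of `G′ = f^{(j+1)}`.  If that point is off the axis it is a
non-real critical point inside `a`ʼs closed Jensen disc (first disjunct of the law); if it is on the chord it is an NL event (second disjunct), because the
axis stretches such a walk can use are exactly the Laguerre-violating ones (`G·G″ ≥ 0` there: the positive face lies above them).  TEETH (real zeros of
`G`) never lie on the closure of a positive face, so — unlike the tongue seal — the link needs no tooth residual; and it needs no radius `δ`, no bad
pieces, no arc count.  Its content is ONE global topological fact about the nodal portrait: «a nodal chain of `∂F_a` leaving the pole `a` changes the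
sign of `Re φ` (e.g. reaches the mate `v`) before it leaves `a`ʼs closed Jensen half-disc».

CONTENT.  §1 `phiAt` (the `φ` of parts C–M off the circle), `LinkCore` / `LeftSign` (the clauses of a link path), ★ `HalfLink f j a` («a nodal path out of
`a`, positive face on the side `κ ∈ {1, −1}`, inside the closed Jensen half-disc, reaching a point where `κ·Re φ ≥ 0`»), `PoleLink f j a v` (the same path
ending at another zero `v`), the OPEN laws ★ `TopLinkLawQ` (every non-isolated simple top is half-linked) and `AtomicLinkLawQ` (the same on part Jʼs atomic
class) · §2 pure analysis, PROVED: `re_monotoneOn_of_nodal_left_nonneg` (part Mʼs lemma mirrored), `norm_logDeriv_large_near` (`‖G′/G‖ → ∞` along a path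
into a simple zero), `exists_re_neg_near_start`, `exists_re_pos_near_end`, ★ `exists_eq_zero_of_link` (monotone + blow-up + IVT ⇒ a zero of `ψ` on the path)
· §3 ★★ `pinning_of_halfLink` (PROVED: on a legal frame a half-linked simple top satisfies the lawʼs disjunction), `halfLink_of_poleLink` (PROVED), ★★ the
glued forms `topPinningResidual_of_atomicLinkSplit : AtomicLinkLawQ → NonAtomicTopResidualQ → TopPinningNonNestedAscResidual`,
`topPinningResidual_of_topLinkLaw : TopLinkLawQ → TopPinningNonNestedAscResidual`, `topPinning_of_topLinkLaw : TopLinkLawQ → TopPinning` (all PROVED),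
and the bookkeeping `atomicLinkLaw_of_topLinkLaw`.

«HALF-LINK» PRECISELY (`HalfLink f j a`, with `G = f^{(j)}`, `φ = G′/G`): a sign `κ = 1` or `κ = −1` and a `C¹` path `σ : [0,1] → ℂ` with `σ 0 = a` such
that for every `s ∈ (0,1)`: `σ s` lies in `a`ʼs CLOSED Jensen disc (`NestedStep a (σ s)`) and in the closed upper half-plane; `G (σ s) ≠ 0`;
`Im φ (σ s) = 0` (nodal); `κ · Im φ ≥ 0` at the points `σ s + ε i σ′ s` for all small `ε > 0` (the positive face on the `κ`-left; vacuous where the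
parametrisation rests, `σ′ s = 0`, which is how corners are traversed); at axis points `G·G″ ≥ 0` (real parts); and SOME `s₂ ∈ (0,1)` has
`κ · Re φ (σ s₂) ≥ 0`.  For `κ = 1` this is the chain of `∂F_a` LEAVING `a` counter-clockwise about the positive face `F_a` below `a` (`Re φ` increases from
`−∞`); for `κ = −1` the clockwise one (`Re φ` decreases from `+∞`).  A constant tail `σ ≡ σ s₂` on `[s₂, 1]` is allowed, so a tracer certifies `HalfLink` by
exhibiting the chain up to its first point with `κ·Re φ ≥ 0`.  `PoleLink f j a v`: the same clauses on `(0,1)` and `σ 1 = v`; for a zero `v` of `G` with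
`G′ v ≠ 0` it implies `HalfLink` (`Re φ → +κ·∞` at `v`).

HOW IT CAN FAIL («strangled top»): both chains of `∂F_a` out of `a` reach `a`ʼs circle (at far ends of bad pieces, with `Re φ` still of the starting
sign) or leave the closed Jensen disc before `Re φ` changes sign — then the level-0 point of `∂F_a` that the law needs (if any) sits on a stretch of `∂F_a`
not adjacent to `a` (e.g. on a tongueʼs sealing arc), and the link says nothing.  On the two-piece atomic portrait the mate `v` is adjacent to `a` on
`∂F_a` (the chain `a → v` is the inner boundary of the sea `S₀`, strictly inside the Jensen disc near `a` since `Im[φ − 1/(z−a)](a) < −1/2`), so the link is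
expected to hold there; no census yet — the CENSUS ASK is on the bus (per J-census class 351 / 532 / 245 / 27 / 8: first event of each chain out of `a`).

HONEST LABEL / PRICE: §2–§3 are PROVED calculus and bookkeeping; the laws `TopLinkLawQ` ⊇ `AtomicLinkLawQ` are OPEN, UNDECIDED, census pending; they are
REFORMULATION-STRENGTH sufficient conditions (each implies the law on its class in forty lines) whose content is the global topology of the nodal set of
`Im (G′/G)` — the same missing machinery as the tongue seal, but ONE statement for all cluster sizes, tooth-free and radius-free.  `TopPinning`, every law of
parts J–M, 33346, 33347 OPEN; nothing here bears on the truth of RH; RH is not proved; checked ≠ landed ≠ proved.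
-/

noncomputable section

namespace RhW08.Lens1ArcSign

open Complex Set Metric Filter Topology
open scoped Real ComplexConjugate
open Literature.Topology.PlaneTopology Literature.Analysis.Complex
open Summit.RiemannHypothesis.RiemannHypothesis.Theorems.Splittings.JensenWindow
open RhIdea6.G17.W07C7 RhIdea6.G17.W07C7.Rev6 RhIdea6.G18.W07C8.Law421BirthS RhIdea6.G19.W07C11.Seam
open RhIdea6.G20.W07C12.Frac RhIdea6.G20.W07C12.StColP RhW07.C12.FieldSplit RhIdea6.G21.W07C13.TentMax
open RhW07.C14.TwoSided RhW07.C14.Classes RhW07.C14.Lineage RhW07.C14.Booking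
open RhW07.C13.Heredity RhIdea6.G22.W07C15pre.Injection RhW07.E3.Cell RhW07.E3.Lit
open RhW08.Round1 RhW08.StSwap RhW08.Round2 RhW08.QuadW RhW08.SealSwapQ RhW08.SealSwap RhW08.SuccB RhW08.SuccSplit
open RhW08.SuccTheft RhW08.Column RhW08.Hurwitz RhW08.ClusterQ RhW08.ClusterQM RhW08.NewtonDoor RhW08.NewtonDoorGenusOne RhW08.PurseP
open RhW08.Lens1SignCut RhW08.Lens1Coverage RhW08.IsolatedTilt RhW08.Lens1Pinning RhW08.Lens1PinningIso

/-! ## §1 Link paths and the link laws (statements) -/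

/-- `φ = (f^{(j)})′ / f^{(j)}` at a point of the plane (parts C–M use it on the circle as `arcPhi`). -/
def phiAt (f : ℂ → ℂ) (j : ℕ) (z : ℂ) : ℂ := deriv (iteratedDeriv j f) z / iteratedDeriv j f z

/-- Consistency with parts C–M: `arcPhi` is `phiAt` on the circle. -/
theorem arcPhi_eq_phiAt (f : ℂ → ℂ) (j : ℕ) (a : ℂ) (δ t : ℝ) : arcPhi f j a δ t = phiAt f j (circleLoop (a.re : ℂ) (a.im + δ) t) := rfl

/-- LINK CORE CLAUSES of a path `σ` on the parameter set `S` (relative to the top zero `a`): inside `a`ʼs CLOSED Jensen disc, in the closed upper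
half-plane, off the zeros of `f^{(j)}`, nodal for `Im φ`, and at axis points Laguerre-violating (`f^{(j)} · f^{(j+2)} ≥ 0`, real parts). -/
def LinkCore (f : ℂ → ℂ) (j : ℕ) (a : ℂ) (σ : ℝ → ℂ) (S : Set ℝ) : Prop :=
  ∀ s ∈ S, NestedStep a (σ s) ∧ 0 ≤ (σ s).im ∧ iteratedDeriv j f (σ s) ≠ 0 ∧ (phiAt f j (σ s)).im = 0 ∧
    ((σ s).im = 0 → 0 ≤ (iteratedDeriv j f (σ s)).re * (iteratedDeriv (j + 2) f (σ s)).re)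

/-- ONE-SIDED SIGN: `κ · Im φ ≥ 0` at the left-offset points `σ s + ε i σ′ s` for all small `ε > 0` (`κ = 1`: positive face on the left; `κ = −1`: on the
right).  Vacuous where `σ′ s = 0`. -/
def LeftSign (f : ℂ → ℂ) (j : ℕ) (σ σ' : ℝ → ℂ) (κ : ℝ) (S : Set ℝ) : Prop :=
  ∀ s ∈ S, ∃ ε₀ : ℝ, 0 < ε₀ ∧ ∀ ε ∈ Ioo (0 : ℝ) ε₀, 0 ≤ κ * (phiAt f j (σ s + (ε : ℂ) * (I * σ' s))).im

/-- ★ HALF-LINK of the zero `a` of `f^{(j)}` (module docstring «HALF-LINK PRECISELY»). -/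
def HalfLink (f : ℂ → ℂ) (j : ℕ) (a : ℂ) : Prop :=
  ∃ κ : ℝ, (κ = 1 ∨ κ = -1) ∧ ∃ σ σ' : ℝ → ℂ, σ 0 = a ∧ (∀ s ∈ Icc (0 : ℝ) 1, HasDerivAt σ (σ' s) s) ∧
    LinkCore f j a σ (Ioo 0 1) ∧ LeftSign f j σ σ' κ (Ioo 0 1) ∧ ∃ s₂ ∈ Ioo (0 : ℝ) 1, 0 ≤ κ * (phiAt f j (σ s₂)).re

/-- ★ POLE-LINK from `a` to `v`: a link path whose far end is `v` (intended: another upper zero of `f^{(j)}`; then `Re φ → κ·∞` there). -/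
def PoleLink (f : ℂ → ℂ) (j : ℕ) (a v : ℂ) : Prop :=
  ∃ κ : ℝ, (κ = 1 ∨ κ = -1) ∧ ∃ σ σ' : ℝ → ℂ, σ 0 = a ∧ σ 1 = v ∧ (∀ s ∈ Icc (0 : ℝ) 1, HasDerivAt σ (σ' s) s) ∧
    LinkCore f j a σ (Ioo 0 1) ∧ LeftSign f j σ σ' κ (Ioo 0 1)

/-- ★ THE TOP LINK LAW (OPEN, UNDECIDED, census pending): on a legal frame, every SIMPLE upper zero `a` of `f^{(j)}` with no taller toucher and SOME
Jensen mate is half-linked.  Sufficient for `TopPinning` outright (`topPinning_of_topLinkLaw`).  WHY IT MIGHT FAIL: a strangled top (module docstring). -/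
def TopLinkLawQ : Prop :=
  ∀ (η : ℝ) (f : ℂ → ℂ) (x₀ s hmax R Hs : ℝ) (B : ℕ), EngineHyps5 2 η f x₀ s hmax R Hs B → ∀ (j : ℕ) (a : ℂ),
    iteratedDeriv j f a = 0 → 0 < a.im → NoTallerToucher f j a → ¬ JensenIsolated f j a → iteratedDeriv (j + 1) f a ≠ 0 → HalfLink f j a

/-- ★ THE ATOMIC LINK LAW (OPEN, UNDECIDED): the same on part Jʼs ATOMIC class, with the binders of `AtomicNetLawQ` (so the two price tags of the atomic
class — NET via parts K–M, LINK via this part — are directly comparable).  Expected certificate: the chain of `∂F_a` from `a` to the mate `v`. -/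
def AtomicLinkLawQ : Prop :=
  ∀ (η : ℝ) (f : ℂ → ℂ) (x₀ s hmax R Hs : ℝ) (B : ℕ), EngineHyps5 2 η f x₀ s hmax R Hs B → ∀ (j : ℕ) (a v : ℂ),
    iteratedDeriv j f a = 0 → 0 < a.im → NoTallerToucher f j a → Atomic f j a v →
    iteratedDeriv (j + 1) f a ≠ 0 → iteratedDeriv (j + 1) f v ≠ 0 → HalfLink f j a

/-- Bookkeeping: the top law contains the atomic one (an atomic mate is a mate). -/
theorem atomicLinkLaw_of_topLinkLaw (h : TopLinkLawQ) : AtomicLinkLawQ :=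
  fun η f x₀ s hmax R Hs B hE j a _ ha hapos hN hA hda _ =>
    h η f x₀ s hmax R Hs B hE j a ha hapos hN (not_jensenIsolated_of_isMate (isMate_of_atomic hA)) hda

/-! ## §2 Pure analysis: monotone + blow-up + IVT along a nodal path -/

/-- Part Mʼs Cauchy–Riemann lemma MIRRORED: nodal path, `Im φ ≥ 0` locally on its LEFT ⇒ `Re φ ∘ σ` is MONOTONE (non-decreasing). -/
theorem re_monotoneOn_of_nodal_left_nonneg {φ : ℂ → ℂ} {σ σ' : ℝ → ℂ} {s₀ s₁ : ℝ}
    (hφ : ∀ s ∈ Icc s₀ s₁, DifferentiableAt ℂ φ (σ s)) (hσ : ∀ s ∈ Icc s₀ s₁, HasDerivAt σ (σ' s) s)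
    (hnodal : ∀ s ∈ Icc s₀ s₁, (φ (σ s)).im = 0)
    (hleft : ∀ s ∈ Icc s₀ s₁, ∃ ε₀ : ℝ, 0 < ε₀ ∧ ∀ ε ∈ Ioo (0 : ℝ) ε₀, 0 ≤ (φ (σ s + (ε : ℂ) * (I * σ' s))).im) :
    MonotoneOn (fun s => (φ (σ s)).re) (Icc s₀ s₁) := by
  have hanti := re_antitoneOn_of_nodal_left (φ := fun z => -φ z) (σ := σ) (σ' := σ') (s₀ := s₀) (s₁ := s₁)
    (fun s hs => (hφ s hs).neg) hσ (fun s hs => by simp [hnodal s hs]) (fun s hs => by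
      obtain ⟨ε₀, hε₀, h⟩ := hleft s hs
      exact ⟨ε₀, hε₀, fun ε hε => by simpa using h ε hε⟩)
  intro s hs t ht hst
  have := hanti hs ht hst
  simp only [Complex.neg_re] at this
  linarith

/-- BLOW-UP: along a path continuous at `s₀` with `σ s₀ = p`, a SIMPLE zero `p` of a differentiable `G` (`G p = 0`, `G′ p ≠ 0`), the logarithmic derivative
`‖G′/G‖` exceeds any bound near `s₀` (wherever `G ≠ 0`). -/
theorem norm_logDeriv_large_near {G : ℂ → ℂ} (hG : Differentiable ℂ G) (hG' : Differentiable ℂ (deriv G)) {p : ℂ} (hp : G p = 0)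
    (hdp : deriv G p ≠ 0) {σ : ℝ → ℂ} {s₀ : ℝ} (hσ : ContinuousAt σ s₀) (hσ₀ : σ s₀ = p) (M : ℝ) :
    ∃ δ : ℝ, 0 < δ ∧ ∀ s : ℝ, |s - s₀| < δ → G (σ s) ≠ 0 → M < ‖deriv G (σ s) / G (σ s)‖ := by
  have hK : 0 < ‖deriv G p‖ := norm_pos_iff.mpr hdp
  set L : ℝ := max M 0 + 1 with hL
  have hL0 : 0 < L := by have := le_max_right M 0; linarith
  have hML : M ≤ L := by have := le_max_left M 0; linarith
  have hc1 : ContinuousAt (G ∘ σ) s₀ := hG.continuous.continuousAt.comp hσ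
  have hc2 : ContinuousAt (deriv G ∘ σ) s₀ := hG'.continuous.continuousAt.comp hσ
  obtain ⟨δ₁, hδ₁, h1⟩ := Metric.continuousAt_iff.mp hc1 (‖deriv G p‖ / (2 * L)) (by positivity)
  obtain ⟨δ₂, hδ₂, h2⟩ := Metric.continuousAt_iff.mp hc2 (‖deriv G p‖ / 2) (by positivity)
  refine ⟨min δ₁ δ₂, lt_min hδ₁ hδ₂, fun s hs hne => ?_⟩
  have hs1 : dist s s₀ < δ₁ := by rw [Real.dist_eq]; exact hs.trans_le (min_le_left _ _)
  have hs2 : dist s s₀ < δ₂ := by rw [Real.dist_eq]; exact hs.trans_le (min_le_right _ _)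
  have e1 : ‖G (σ s)‖ < ‖deriv G p‖ / (2 * L) := by
    have := h1 hs1
    rwa [dist_eq_norm, Function.comp_apply, Function.comp_apply, hσ₀, hp, sub_zero] at this
  have e2 : ‖deriv G p‖ / 2 < ‖deriv G (σ s)‖ := by
    have h3 := h2 hs2
    rw [dist_eq_norm, Function.comp_apply, Function.comp_apply, hσ₀] at h3
    have h4 : ‖deriv G p‖ - ‖deriv G (σ s)‖ ≤ ‖deriv G (σ s) - deriv G p‖ := by
      rw [norm_sub_rev]; exact norm_sub_norm_le _ _
    linarith
  have hGpos : 0 < ‖G (σ s)‖ := norm_pos_iff.mpr hne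
  rw [norm_div, lt_div_iff₀ hGpos]
  calc M * ‖G (σ s)‖ ≤ L * ‖G (σ s)‖ := mul_le_mul_of_nonneg_right hML hGpos.le
    _ ≤ L * (‖deriv G p‖ / (2 * L)) := mul_le_mul_of_nonneg_left e1.le hL0.le
    _ = ‖deriv G p‖ / 2 := by field_simp
    _ < ‖deriv G (σ s)‖ := e2

/-- START SIGN: a nodal path with `Im ψ ≥ 0` locally on its left, along which `‖ψ‖ → ∞` at the start, has `Re ψ < 0` somewhere in `(0, s₂]` for every
`s₂ ∈ (0,1)` (monotone and unbounded near `0` forces `Re ψ → −∞`). -/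
theorem exists_re_neg_near_start {ψ : ℂ → ℂ} {σ σ' : ℝ → ℂ} (hσ : ∀ s ∈ Icc (0 : ℝ) 1, HasDerivAt σ (σ' s) s)
    (hψ : ∀ s ∈ Ioo (0 : ℝ) 1, DifferentiableAt ℂ ψ (σ s)) (hnodal : ∀ s ∈ Ioo (0 : ℝ) 1, (ψ (σ s)).im = 0)
    (hleft : ∀ s ∈ Ioo (0 : ℝ) 1, ∃ ε₀ : ℝ, 0 < ε₀ ∧ ∀ ε ∈ Ioo (0 : ℝ) ε₀, 0 ≤ (ψ (σ s + (ε : ℂ) * (I * σ' s))).im)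
    (hblow : ∀ M : ℝ, ∃ δ : ℝ, 0 < δ ∧ ∀ s ∈ Ioo (0 : ℝ) 1, s < δ → M < ‖ψ (σ s)‖) {s₂ : ℝ} (hs₂ : s₂ ∈ Ioo (0 : ℝ) 1) :
    ∃ s₁ ∈ Ioc (0 : ℝ) s₂, (ψ (σ s₁)).re < 0 := by
  by_contra hcon
  push Not at hcon
  obtain ⟨δ, hδ, hbig⟩ := hblow ((ψ (σ s₂)).re)
  set s₁ : ℝ := min (δ / 2) s₂ with hs₁def
  have h0 : 0 < s₁ := lt_min (by linarith) hs₂.1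
  have h1 : s₁ ≤ s₂ := min_le_right _ _
  have hI : s₁ ∈ Ioo (0 : ℝ) 1 := ⟨h0, h1.trans_lt hs₂.2⟩
  have hre : 0 ≤ (ψ (σ s₁)).re := hcon s₁ ⟨h0, h1⟩
  have hsub : Icc s₁ s₂ ⊆ Ioo (0 : ℝ) 1 := fun s hs => ⟨h0.trans_le hs.1, hs.2.trans_lt hs₂.2⟩
  have hmono := re_monotoneOn_of_nodal_left_nonneg (fun s hs => hψ s (hsub hs))
    (fun s hs => hσ s ⟨(hsub hs).1.le, (hsub hs).2.le⟩) (fun s hs => hnodal s (hsub hs)) (fun s hs => hleft s (hsub hs))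
  have hle : (ψ (σ s₁)).re ≤ (ψ (σ s₂)).re := hmono ⟨le_rfl, h1⟩ ⟨h1, le_rfl⟩ h1
  have hnorm : ‖ψ (σ s₁)‖ ≤ (ψ (σ s₁)).re := by
    have := Complex.norm_le_abs_re_add_abs_im (ψ (σ s₁))
    rwa [hnodal s₁ hI, abs_zero, add_zero, abs_of_nonneg hre] at this
  have hlt := hbig s₁ hI ((min_le_left _ _).trans_lt (by linarith))
  linarith

/-- END SIGN: the mirror statement at the far end — `‖ψ‖ → ∞` at `s = 1` forces `Re ψ > 0` somewhere in `[s₁, 1)`. -/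
theorem exists_re_pos_near_end {ψ : ℂ → ℂ} {σ σ' : ℝ → ℂ} (hσ : ∀ s ∈ Icc (0 : ℝ) 1, HasDerivAt σ (σ' s) s)
    (hψ : ∀ s ∈ Ioo (0 : ℝ) 1, DifferentiableAt ℂ ψ (σ s)) (hnodal : ∀ s ∈ Ioo (0 : ℝ) 1, (ψ (σ s)).im = 0)
    (hleft : ∀ s ∈ Ioo (0 : ℝ) 1, ∃ ε₀ : ℝ, 0 < ε₀ ∧ ∀ ε ∈ Ioo (0 : ℝ) ε₀, 0 ≤ (ψ (σ s + (ε : ℂ) * (I * σ' s))).im)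
    (hblow : ∀ M : ℝ, ∃ δ : ℝ, 0 < δ ∧ ∀ s ∈ Ioo (0 : ℝ) 1, 1 - δ < s → M < ‖ψ (σ s)‖) {s₁ : ℝ} (hs₁ : s₁ ∈ Ioo (0 : ℝ) 1) :
    ∃ s₂ ∈ Ico s₁ 1, 0 < (ψ (σ s₂)).re := by
  by_contra hcon
  push Not at hcon
  obtain ⟨δ, hδ, hbig⟩ := hblow (-(ψ (σ s₁)).re)
  set s₂ : ℝ := max (1 - δ / 2) s₁ with hs₂def
  have h1 : s₁ ≤ s₂ := le_max_right _ _
  have h2 : s₂ < 1 := max_lt (by linarith) hs₁.2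
  have hI : s₂ ∈ Ioo (0 : ℝ) 1 := ⟨hs₁.1.trans_le h1, h2⟩
  have hre : (ψ (σ s₂)).re ≤ 0 := hcon s₂ ⟨h1, h2⟩
  have hsub : Icc s₁ s₂ ⊆ Ioo (0 : ℝ) 1 := fun s hs => ⟨hs₁.1.trans_le hs.1, hs.2.trans_lt h2⟩
  have hmono := re_monotoneOn_of_nodal_left_nonneg (fun s hs => hψ s (hsub hs))
    (fun s hs => hσ s ⟨(hsub hs).1.le, (hsub hs).2.le⟩) (fun s hs => hnodal s (hsub hs)) (fun s hs => hleft s (hsub hs))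
  have hle : (ψ (σ s₁)).re ≤ (ψ (σ s₂)).re := hmono ⟨le_rfl, h1⟩ ⟨h1, le_rfl⟩ h1
  have hnorm : ‖ψ (σ s₂)‖ ≤ -(ψ (σ s₂)).re := by
    have := Complex.norm_le_abs_re_add_abs_im (ψ (σ s₂))
    rwa [hnodal s₂ hI, abs_zero, add_zero, abs_of_nonpos hre] at this
  have hlt := hbig s₂ hI ((by linarith : 1 - δ < 1 - δ / 2).trans_le (le_max_left _ _))
  linarith

/-- ★ THE LINK LEMMA (pure analysis): start sign `< 0` (from the blow-up) and a point with `Re ψ ≥ 0` give, by the intermediate value theorem and the nodal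
condition, a point of the path with `ψ = 0`. -/
theorem exists_eq_zero_of_link {ψ : ℂ → ℂ} {σ σ' : ℝ → ℂ} (hσ : ∀ s ∈ Icc (0 : ℝ) 1, HasDerivAt σ (σ' s) s)
    (hψ : ∀ s ∈ Ioo (0 : ℝ) 1, DifferentiableAt ℂ ψ (σ s)) (hnodal : ∀ s ∈ Ioo (0 : ℝ) 1, (ψ (σ s)).im = 0)
    (hleft : ∀ s ∈ Ioo (0 : ℝ) 1, ∃ ε₀ : ℝ, 0 < ε₀ ∧ ∀ ε ∈ Ioo (0 : ℝ) ε₀, 0 ≤ (ψ (σ s + (ε : ℂ) * (I * σ' s))).im)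
    (hblow : ∀ M : ℝ, ∃ δ : ℝ, 0 < δ ∧ ∀ s ∈ Ioo (0 : ℝ) 1, s < δ → M < ‖ψ (σ s)‖)
    {s₂ : ℝ} (hs₂ : s₂ ∈ Ioo (0 : ℝ) 1) (hpos : 0 ≤ (ψ (σ s₂)).re) : ∃ s ∈ Ioc (0 : ℝ) s₂, ψ (σ s) = 0 := by
  obtain ⟨s₁, hs₁, hneg⟩ := exists_re_neg_near_start hσ hψ hnodal hleft hblow hs₂
  have hsub : Icc s₁ s₂ ⊆ Ioo (0 : ℝ) 1 := fun s hs => ⟨hs₁.1.trans_le hs.1, hs.2.trans_lt hs₂.2⟩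
  have hcont : ContinuousOn (fun s => (ψ (σ s)).re) (Icc s₁ s₂) := by
    intro s hs
    have h1 : ContinuousAt (ψ ∘ σ) s :=
      (hψ s (hsub hs)).continuousAt.comp (hσ s ⟨(hsub hs).1.le, (hsub hs).2.le⟩).continuousAt
    exact (Complex.continuous_re.continuousAt.comp h1).continuousWithinAt
  obtain ⟨s, hs, hs0⟩ := intermediate_value_Icc hs₁.2 hcont ⟨hneg.le, hpos⟩
  exact ⟨s, ⟨hs₁.1.trans_le hs.1, hs.2⟩, Complex.ext (by simpa using hs0) (by simpa using hnodal s (hsub hs))⟩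

/-! ## §3 The link pays: half-link ⇒ the disjunction of the law; glued forms -/

/-- The derived objects of a legal frame used below: `G = f^{(j)}` is real-entire and `G′ = f^{(j+1)}` is differentiable. -/
theorem differentiable_deriv_iteratedDeriv {η : ℝ} {f : ℂ → ℂ} {x₀ s hmax R Hs : ℝ} {B : ℕ} (hE : EngineHyps5 2 η f x₀ s hmax R Hs B) (j : ℕ) :
    Differentiable ℂ (deriv (iteratedDeriv j f)) := by
  rw [← iteratedDeriv_succ]; exact (RhW08.WindowLoss.realEntireLt2_iteratedDeriv (realEntireLt2_of_hyps hE) (j + 1)).diff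

/-- The four abstract hypotheses of §2 for `ψ = κ · φ` along a link path (`|κ| = 1`). -/
theorem link_hyps {η : ℝ} {f : ℂ → ℂ} {x₀ s hmax R Hs : ℝ} {B : ℕ} (hE : EngineHyps5 2 η f x₀ s hmax R Hs B) {j : ℕ} {a : ℂ}
    {κ : ℝ} (hκ : κ = 1 ∨ κ = -1) {σ σ' : ℝ → ℂ} (hcore : LinkCore f j a σ (Ioo 0 1)) (hsign : LeftSign f j σ σ' κ (Ioo 0 1)) :
    (∀ s ∈ Ioo (0 : ℝ) 1, DifferentiableAt ℂ (fun z => (κ : ℂ) * phiAt f j z) (σ s)) ∧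
    (∀ s ∈ Ioo (0 : ℝ) 1, ((fun z => (κ : ℂ) * phiAt f j z) (σ s)).im = 0) ∧
    (∀ s ∈ Ioo (0 : ℝ) 1, ∃ ε₀ : ℝ, 0 < ε₀ ∧ ∀ ε ∈ Ioo (0 : ℝ) ε₀,
      0 ≤ ((fun z => (κ : ℂ) * phiAt f j z) (σ s + (ε : ℂ) * (I * σ' s))).im) ∧
    (∀ z : ℂ, ‖(fun z => (κ : ℂ) * phiAt f j z) z‖ = ‖deriv (iteratedDeriv j f) z / iteratedDeriv j f z‖) := by
  have hG : RealEntireLt2 (iteratedDeriv j f) := RhW08.WindowLoss.realEntireLt2_iteratedDeriv (realEntireLt2_of_hyps hE) j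
  have hG'd := differentiable_deriv_iteratedDeriv hE j
  have hκ1 : ‖(κ : ℂ)‖ = 1 := by rcases hκ with rfl | rfl <;> simp
  refine ⟨fun s hs => ?_, fun s hs => ?_, fun s hs => ?_, fun z => ?_⟩
  · exact (((hG'd _).div (hG.diff _) (hcore s hs).2.2.1).const_mul (κ : ℂ))
  · simp [(hcore s hs).2.2.2.1]
  · obtain ⟨ε₀, hε₀, h⟩ := hsign s hs
    exact ⟨ε₀, hε₀, fun ε hε => by simpa [Complex.im_ofReal_mul] using h ε hε⟩
  · simp only [norm_mul, hκ1, one_mul]; rfl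

/-- ★★ HALF-LINK PAYS (PROVED): on a legal frame, a SIMPLE upper zero `a` of `f^{(j)}` that is half-linked has a non-real zero of `f^{(j+1)}` in its closed
Jensen disc or an NL event in its closed Jensen interval — the disjunction of `TopPinning`. -/
theorem pinning_of_halfLink {η : ℝ} {f : ℂ → ℂ} {x₀ s hmax R Hs : ℝ} {B : ℕ} (hE : EngineHyps5 2 η f x₀ s hmax R Hs B)
    {j : ℕ} {a : ℂ} (ha : iteratedDeriv j f a = 0) (hapos : 0 < a.im) (hda : iteratedDeriv (j + 1) f a ≠ 0) (hL : HalfLink f j a) :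
    (∃ w : ℂ, iteratedDeriv (j + 1) f w = 0 ∧ w.im ≠ 0 ∧ NestedStep a w) ∨ (∃ x : ℝ, |x - a.re| ≤ a.im ∧ NLEventOf f j x) := by
  classical
  have hG : RealEntireLt2 (iteratedDeriv j f) := RhW08.WindowLoss.realEntireLt2_iteratedDeriv (realEntireLt2_of_hyps hE) j
  have hG'd := differentiable_deriv_iteratedDeriv hE j
  have e1 : deriv (iteratedDeriv j f) = iteratedDeriv (j + 1) f := by rw [← iteratedDeriv_succ]
  obtain ⟨κ, hκ, σ, σ', hσ0, hσ, hcore, hsign, s₂, hs₂, hpos⟩ := hL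
  have hκ0 : (κ : ℂ) ≠ 0 := by rcases hκ with rfl | rfl <;> simp
  obtain ⟨hψd, hnodal, hleft, hnorm⟩ := link_hyps hE hκ hcore hsign
  have hne : ∀ s ∈ Ioo (0 : ℝ) 1, iteratedDeriv j f (σ s) ≠ 0 := fun s hs => (hcore s hs).2.2.1
  have hblow : ∀ M : ℝ, ∃ δ : ℝ, 0 < δ ∧ ∀ s ∈ Ioo (0 : ℝ) 1, s < δ → M < ‖(fun z => (κ : ℂ) * phiAt f j z) (σ s)‖ := by
    intro M
    obtain ⟨δ, hδ, h⟩ := norm_logDeriv_large_near hG.diff hG'd ha (by rwa [e1]) (hσ 0 ⟨le_rfl, zero_le_one⟩).continuousAt hσ0 M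
    exact ⟨δ, hδ, fun s hs hsδ => by rw [hnorm]; exact h s (by rwa [sub_zero, abs_of_pos hs.1]) (hne s hs)⟩
  have hpos' : 0 ≤ ((fun z => (κ : ℂ) * phiAt f j z) (σ s₂)).re := by simpa [Complex.re_ofReal_mul] using hpos
  obtain ⟨t, ht, hψ0⟩ := exists_eq_zero_of_link hσ hψd hnodal hleft hblow hs₂ hpos'
  have htI : t ∈ Ioo (0 : ℝ) 1 := ⟨ht.1, ht.2.trans_lt hs₂.2⟩
  obtain ⟨hnest, -, hGne, -, hchord⟩ := hcore t htI
  have hφ0 : phiAt f j (σ t) = 0 := (mul_eq_zero.mp hψ0).resolve_left hκ0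
  have hzero : iteratedDeriv (j + 1) f (σ t) = 0 := by
    unfold phiAt at hφ0
    have := (div_eq_zero_iff.mp hφ0).resolve_right hGne
    rwa [e1] at this
  by_cases hw : (σ t).im = 0
  · right
    have hx : (((σ t).re : ℝ) : ℂ) = σ t := Complex.ext (by simp) (by simp [hw])
    refine ⟨(σ t).re, ?_, ?_⟩
    · have h1 : ((σ t).re - a.re) ^ 2 + (σ t).im ^ 2 ≤ a.im ^ 2 := hnest
      rw [hw] at h1
      exact abs_le_of_sq_le_sq (by nlinarith) hapos.le
    · have hGim : (iteratedDeriv j f (σ t)).im = 0 := by rw [← hx]; exact hG.real _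
      refine ⟨by rw [hx, hzero, Complex.zero_re], fun h0 => hGne ?_, by rw [hx]; exact hchord hw⟩
      rw [hx] at h0
      exact Complex.ext (by simpa using h0) (by simpa using hGim)
  · exact Or.inl ⟨σ t, hzero, hw, hnest⟩

/-- A pole-link to a SIMPLE zero `v` of `f^{(j)}` is a half-link (`Re φ → κ·∞` at `v`, by §2ʼs end-sign lemma). -/
theorem halfLink_of_poleLink {η : ℝ} {f : ℂ → ℂ} {x₀ s hmax R Hs : ℝ} {B : ℕ} (hE : EngineHyps5 2 η f x₀ s hmax R Hs B)
    {j : ℕ} {a v : ℂ} (hv : iteratedDeriv j f v = 0) (hdv : iteratedDeriv (j + 1) f v ≠ 0) (h : PoleLink f j a v) : HalfLink f j a := by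
  classical
  have hG : RealEntireLt2 (iteratedDeriv j f) := RhW08.WindowLoss.realEntireLt2_iteratedDeriv (realEntireLt2_of_hyps hE) j
  have hG'd := differentiable_deriv_iteratedDeriv hE j
  have e1 : deriv (iteratedDeriv j f) = iteratedDeriv (j + 1) f := by rw [← iteratedDeriv_succ]
  obtain ⟨κ, hκ, σ, σ', hσ0, hσ1, hσ, hcore, hsign⟩ := h
  obtain ⟨hψd, hnodal, hleft, hnorm⟩ := link_hyps hE hκ hcore hsign
  have hne : ∀ s ∈ Ioo (0 : ℝ) 1, iteratedDeriv j f (σ s) ≠ 0 := fun s hs => (hcore s hs).2.2.1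
  have hblow : ∀ M : ℝ, ∃ δ : ℝ, 0 < δ ∧ ∀ s ∈ Ioo (0 : ℝ) 1, 1 - δ < s → M < ‖(fun z => (κ : ℂ) * phiAt f j z) (σ s)‖ := by
    intro M
    obtain ⟨δ, hδ, h⟩ := norm_logDeriv_large_near hG.diff hG'd hv (by rwa [e1]) (hσ 1 ⟨zero_le_one, le_rfl⟩).continuousAt hσ1 M
    refine ⟨δ, hδ, fun s hs hsδ => ?_⟩
    rw [hnorm]
    exact h s (by rw [abs_sub_lt_iff]; constructor <;> linarith [hs.2]) (hne s hs)
  obtain ⟨s₂, hs₂, hpos⟩ := exists_re_pos_near_end hσ hψd hnodal hleft hblow (s₁ := 1 / 2) ⟨by norm_num, by norm_num⟩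
  refine ⟨κ, hκ, σ, σ', hσ0, hσ, hcore, hsign, s₂, ⟨by linarith [hs₂.1], hs₂.2⟩, ?_⟩
  have : ((fun z => (κ : ℂ) * phiAt f j z) (σ s₂)).re = κ * (phiAt f j (σ s₂)).re := by simp
  linarith

/-- ★ THE ATOMIC BRANCH via the LINK: the atomic link law pays the atomic class (multiple `a` or `v` ⇒ that point is itself the child, as in part J). -/
theorem pinning_of_atomicLink (hL : AtomicLinkLawQ) {η : ℝ} {f : ℂ → ℂ} {x₀ s hmax R Hs : ℝ} {B : ℕ} (hE : EngineHyps5 2 η f x₀ s hmax R Hs B)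
    {j : ℕ} {a v : ℂ} (ha : iteratedDeriv j f a = 0) (hapos : 0 < a.im) (hN : NoTallerToucher f j a) (hA : Atomic f j a v) :
    (∃ w : ℂ, iteratedDeriv (j + 1) f w = 0 ∧ w.im ≠ 0 ∧ NestedStep a w) ∨ (∃ x : ℝ, |x - a.re| ≤ a.im ∧ NLEventOf f j x) := by
  by_cases hda : iteratedDeriv (j + 1) f a = 0
  · exact Or.inl ⟨a, hda, hapos.ne', by show (a.re - a.re) ^ 2 + a.im ^ 2 ≤ a.im ^ 2; simp⟩
  by_cases hdv : iteratedDeriv (j + 1) f v = 0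
  · exact Or.inl ⟨v, hdv, hA.2.1.ne', nestedStep_of_norm_le hA.2.2.2.1⟩
  exact pinning_of_halfLink hE ha hapos hda (hL η f x₀ s hmax R Hs B hE j a v ha hapos hN hA hda hdv)

/-- ★★ THE GLUED SPLIT (link form): `AtomicLinkLawQ → NonAtomicTopResidualQ → TopPinningNonNestedAscResidual` (PROVED). -/
theorem topPinningResidual_of_atomicLinkSplit (hL : AtomicLinkLawQ) (hR : NonAtomicTopResidualQ) : TopPinningNonNestedAscResidual := by
  intro η f x₀ s hmax R Hs B hE j a ha hapos hN hJ hS hA hM hnest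
  by_cases hat : ∃ v : ℂ, Atomic f j a v
  · obtain ⟨v, hv⟩ := hat
    exact pinning_of_atomicLink hL hE ha hapos hN hv
  · push Not at hat
    exact hR η f x₀ s hmax R Hs B hE j a ha hapos hN hJ hS hA hM hnest hat

/-- ★★ NO RESIDUAL: the TOP link law alone gives part Iʼs residual (PROVED; multiple `a` is its own child). -/
theorem topPinningResidual_of_topLinkLaw (hL : TopLinkLawQ) : TopPinningNonNestedAscResidual := by
  intro η f x₀ s hmax R Hs B hE j a ha hapos hN hJ _ _ _ _
  by_cases hda : iteratedDeriv (j + 1) f a = 0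
  · exact Or.inl ⟨a, hda, hapos.ne', by show (a.re - a.re) ^ 2 + a.im ^ 2 ≤ a.im ^ 2; simp⟩
  exact pinning_of_halfLink hE ha hapos hda (hL η f x₀ s hmax R Hs B hE j a ha hapos hN hJ hda)

/-- ★★★ … hence `TopLinkLawQ → TopPinning` (part I closes the isolated and descending branches). -/
theorem topPinning_of_topLinkLaw (hL : TopLinkLawQ) : TopPinning :=
  topPinning_of_nonNestedAscResidual (topPinningResidual_of_topLinkLaw hL)

/-- … and via part Jʼs residual: `AtomicLinkLawQ → NonAtomicTopResidualQ → TopPinning`. -/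
theorem topPinning_of_atomicLinkSplit (hL : AtomicLinkLawQ) (hR : NonAtomicTopResidualQ) : TopPinning :=
  topPinning_of_nonNestedAscResidual (topPinningResidual_of_atomicLinkSplit hL hR)

end RhW08.Lens1ArcSign



/-!
# TiltedLandingLaw421R3 — lens-1 (part P): LINK START — the second-order form of the nodal link is exactly `NoTallerToucher`

LENS-1 gen-8 module image `rh33346-cover/lens-1/LinkStart-v1.lean` (landing target `…/Theorems/TiltedLandingLaw421R3Lens1ArcSignP.lean`; ONE import =
part N `…R3Lens1ArcSignN` (the link it localises); namespace `RhW08.Lens1ArcSign`; 0 `sorry`; checked BY CHAIN over the tree part M with N inlined).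

THE COMPUTATION.  Let `G = f^{(j)}`, `a` a SIMPLE upper zero, `φ = G′/G`.  Near `a`, `φ(z) = 1/(z − a) + h₀ + O(z − a)` with the LINK RESIDUE
`h₀ = G″(a)/(2G′(a))` (`linkResidue`).  The two nodal chains of `{Im φ = 0}` leave `a` horizontally along `Im z − Im a ≈ (Im h₀)·(Re z − Re a)²`, while
aʼs Jensen circle is `Im z − Im a ≈ −(Re z − Re a)²/(2·Im a)`: the chains ENTER the open Jensen disc iff `Im h₀ < −1/(2·Im a)`, i.e. iff
`Im(G″(a)/G′(a)) < −1/Im a`.  For a real `G` whose zero set is `{a, ā} ∪ {r, r̄ : r ∈ Z} ∪ T` (`Z` upper zeros, `T` real zeros) and for which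
`φ − 1/(z−a)` has the partial-fraction value `h₀ = 1/(a − ā) + Σ_{r ∈ Z} (1/(a − r) + 1/(a − r̄)) + Σ_{t ∈ T} 1/(a − t)` (polynomials; the genus-≤1 Hadamard
class after the usual real normalisation), one has `Im(1/(a − ā)) = −1/(2·Im a)` EXACTLY (`im_inv_sub_conj_self`), every tooth term is `< 0`
(`im_inv_sub_real_neg`), and the PAIR TERM `Im(1/(a−r)) + Im(1/(a−r̄)) = 2·Im a·(Im r² − Im a² − (Re r − Re a)²)/(|a−r|²·|a−r̄|²)` (`im_pair_eq`) is NEGATIVE iff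
`Im r² < Im a² + (Re r − Re a)²` — the zero `r` lies below the hyperbolic cap with apex `a` — which `NoTallerToucher f j a` implies for every zero `r ≠ a`
of `f^{(j)}` (`cap_of_noTallerToucher`: taller ⇒ `(Re r − Re a)² > (Im a + Im r)² > Im r² − Im a²`; not taller ⇒ trivial unless `r = a`).  So, IN THE MODEL,
`Im h₀ ≤ −1/(2·Im a)` with equality iff `Z = T = ∅` (the lone pair, whose nodal set IS the Jensen circle): ★★ `linkStart_model` (PROVED, finite sums).
A taller TOUCHER straight above `a` makes its pair term positive (e.g. `+0.62` at `r = 1/2 + 3i/2` for `a = i`) and pushes the chains OUT of the disc at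
second order — the lawʼs hypothesis and the linkʼs start condition coincide.

TYPED (OPEN in tree terms): ★ `LinkStartLawQ` — on a legal frame, for a simple upper zero `a` with `NoTallerToucher`: `Im(f^{(j+2)}(a)/f^{(j+1)}(a)) ≤ −1/Im a`.
What separates it from `linkStart_model` is ONLY the partial-fraction expansion of `G′/G − 1/(z − a)` at `a` for the treeʼs real order-`< 2` class
(`RhW08.WindowLoss.realEntireLt2_iteratedDeriv`), not in the tree; recorded, not claimed.  This part does NOT prove that the chains enter the disc (that is the
implicit-function reading of the inequality) and does not touch `TopLinkLawQ`; it isolates the local inequality and proves its algebraic heart.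

HONEST LABEL.  `LinkStartLawQ`, `TopLinkLawQ`, `AtomicLinkLawQ`, every atomic law, `TopPinning`, ⟨33346⟩/⟨33347⟩ OPEN or UNDECIDED; toy numbers
(`lens-1/linktoy/LINKTOY-NOTE.md`) are floats; nothing in this file bears on the truth of RH; RH is not proved.
-/

noncomputable section

namespace RhW08.Lens1ArcSign

open Complex Set Metric Filter Topology
open scoped Real ComplexConjugate
open Literature.Topology.PlaneTopology Literature.Analysis.Complex
open Summit.RiemannHypothesis.RiemannHypothesis.Theorems.Splittings.JensenWindow
open RhIdea6.G17.W07C7 RhIdea6.G17.W07C7.Rev6 RhIdea6.G18.W07C8.Law421BirthS RhIdea6.G19.W07C11.Seam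
open RhIdea6.G20.W07C12.Frac RhIdea6.G20.W07C12.StColP RhW07.C12.FieldSplit RhIdea6.G21.W07C13.TentMax
open RhW07.C14.TwoSided RhW07.C14.Classes RhW07.C14.Lineage RhW07.C14.Booking
open RhW07.C13.Heredity RhIdea6.G22.W07C15pre.Injection RhW07.E3.Cell RhW07.E3.Lit
open RhW08.Round1 RhW08.StSwap RhW08.Round2 RhW08.QuadW RhW08.SealSwapQ RhW08.SealSwap RhW08.SuccB RhW08.SuccSplit
open RhW08.SuccTheft RhW08.Column RhW08.Hurwitz RhW08.ClusterQ RhW08.ClusterQM RhW08.NewtonDoor RhW08.NewtonDoorGenusOne RhW08.PurseP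
open RhW08.Lens1SignCut RhW08.Lens1Coverage RhW08.IsolatedTilt RhW08.Lens1Pinning RhW08.Lens1PinningIso

/-! ## §1 The link residue and the typed law -/

/-- The LINK RESIDUE `h₀ = G″(a)/(2G′(a))`, `G = f^{(j)}`: the constant term of `G′/G − 1/(z − a)` at a simple zero `a`. -/
def linkResidue (f : ℂ → ℂ) (j : ℕ) (a : ℂ) : ℂ := iteratedDeriv (j + 2) f a / (2 * iteratedDeriv (j + 1) f a)

/-- ★ LINK START LAW (OPEN, typed): on a legal frame, at a SIMPLE upper zero `a` of `f^{(j)}` with no taller toucher,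
`Im(f^{(j+2)}(a)/f^{(j+1)}(a)) ≤ −1/Im a` — the second-order statement that both nodal chains of `Im(f^{(j+1)}/f^{(j)})` out of `a` enter aʼs Jensen disc. -/
def LinkStartLawQ : Prop :=
  ∀ (η : ℝ) (f : ℂ → ℂ) (x₀ s hmax R Hs : ℝ) (B : ℕ), EngineHyps5 2 η f x₀ s hmax R Hs B → ∀ (j : ℕ) (a : ℂ),
    iteratedDeriv j f a = 0 → 0 < a.im → NoTallerToucher f j a → iteratedDeriv (j + 1) f a ≠ 0 →
    (iteratedDeriv (j + 2) f a / iteratedDeriv (j + 1) f a).im ≤ -1 / a.im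

/-- Bookkeeping: the law in residue form (`2·Im h₀ ≤ −1/Im a`). -/
theorem linkStartLaw_residue_form (hL : LinkStartLawQ) {η : ℝ} {f : ℂ → ℂ} {x₀ s hmax R Hs : ℝ} {B : ℕ}
    (hE : EngineHyps5 2 η f x₀ s hmax R Hs B) {j : ℕ} {a : ℂ} (ha : iteratedDeriv j f a = 0) (hapos : 0 < a.im)
    (hN : NoTallerToucher f j a) (hs : iteratedDeriv (j + 1) f a ≠ 0) :
    2 * (linkResidue f j a).im ≤ -1 / a.im := by
  have h := hL η f x₀ s hmax R Hs B hE j a ha hapos hN hs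
  have e : linkResidue f j a = ((1 / 2 : ℝ) : ℂ) * (iteratedDeriv (j + 2) f a / iteratedDeriv (j + 1) f a) := by
    unfold linkResidue; push_cast; ring
  rw [e, Complex.im_ofReal_mul]
  linarith

/-! ## §2 The pair term (real algebra) -/

/-- The PAIR TERM in real coordinates: `p = Re r − Re a`, `y = Im r`, `q = Im a`. -/
def pairTerm (p y q : ℝ) : ℝ := (y - q) / (p ^ 2 + (y - q) ^ 2) + (-y - q) / (p ^ 2 + (y + q) ^ 2)

/-- Closed form of the pair term: `2q(y² − q² − p²)/(|a−r|²|a−r̄|²)`. -/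
theorem pairTerm_eq (p y q : ℝ) (h₁ : p ^ 2 + (y - q) ^ 2 ≠ 0) (h₂ : p ^ 2 + (y + q) ^ 2 ≠ 0) :
    pairTerm p y q = 2 * q * (y ^ 2 - q ^ 2 - p ^ 2) / ((p ^ 2 + (y - q) ^ 2) * (p ^ 2 + (y + q) ^ 2)) := by
  unfold pairTerm
  field_simp
  ring

/-- The pair term is NEGATIVE exactly below the hyperbolic cap `y² < q² + p²` (given `q > 0`, `y > 0`). -/
theorem pairTerm_neg {p y q : ℝ} (hq : 0 < q) (hy : 0 < y) (hcap : y ^ 2 < q ^ 2 + p ^ 2) : pairTerm p y q < 0 := by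
  have h₂ : 0 < p ^ 2 + (y + q) ^ 2 := by positivity
  have h₁ : 0 < p ^ 2 + (y - q) ^ 2 := by
    by_contra hle
    have hp : p ^ 2 = 0 := by nlinarith [sq_nonneg p, sq_nonneg (y - q)]
    have hyq : (y - q) ^ 2 = 0 := by nlinarith [sq_nonneg p, sq_nonneg (y - q)]
    have hy' : y = q := by
      have h0 : y - q = 0 := pow_eq_zero_iff (n := 2) (by norm_num) |>.mp hyq
      linarith
    rw [hy', hp] at hcap
    linarith
  rw [pairTerm_eq p y q h₁.ne' h₂.ne']
  apply div_neg_of_neg_of_pos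
  · nlinarith
  · positivity

/-- `NoTallerToucher`-shaped hypothesis ⇒ below the cap: a zero that is not `a` itself and, if taller, does not touch, satisfies `y² < q² + p²`. -/
theorem cap_of_noTallerToucher {p y q : ℝ} (hq : 0 < q) (hy : 0 < y) (hne : ¬ (p = 0 ∧ y = q))
    (hN : q < y → q + y < |p|) : y ^ 2 < q ^ 2 + p ^ 2 := by
  rcases lt_trichotomy y q with hlt | heq | hgt
  · nlinarith [sq_nonneg p]
  · subst heq
    have hp : p ≠ 0 := fun h => hne ⟨h, rfl⟩
    have : 0 < p ^ 2 := by positivity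
    linarith
  · have h := hN hgt
    have hab : (q + y) ^ 2 < p ^ 2 := by
      have h0 : 0 ≤ q + y := by linarith
      calc (q + y) ^ 2 < |p| ^ 2 := by exact pow_lt_pow_left₀ h h0 (by norm_num)
        _ = p ^ 2 := sq_abs p
    nlinarith

/-! ## §3 Complex-to-real bridge -/

/-- `Im(1/(a − r))` in coordinates. -/
theorem im_one_div_sub (a r : ℂ) :
    (1 / (a - r)).im = (r.im - a.im) / ((r.re - a.re) ^ 2 + (r.im - a.im) ^ 2) := by
  rw [one_div, Complex.inv_im, Complex.normSq_apply]
  simp only [Complex.sub_re, Complex.sub_im]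
  have : (a.re - r.re) * (a.re - r.re) + (a.im - r.im) * (a.im - r.im) = (r.re - a.re) ^ 2 + (r.im - a.im) ^ 2 := by ring
  rw [this]; ring

/-- The self-conjugate term: `Im(1/(a − ā)) = −1/(2·Im a)`. -/
theorem im_inv_sub_conj_self (a : ℂ) (ha : 0 < a.im) : (1 / (a - conj a)).im = -1 / (2 * a.im) := by
  rw [im_one_div_sub]
  simp only [Complex.conj_re, Complex.conj_im]
  have h : (a.re - a.re) ^ 2 + (-a.im - a.im) ^ 2 = (2 * a.im) * (2 * a.im) := by ring
  rw [h]
  field_simp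
  ring

/-- A tooth term is negative: `Im(1/(a − t)) < 0` for real `t`. -/
theorem im_inv_sub_real_neg (a : ℂ) (t : ℝ) (ha : 0 < a.im) : (1 / (a - (t : ℂ))).im < 0 := by
  rw [im_one_div_sub]
  simp only [Complex.ofReal_re, Complex.ofReal_im]
  apply div_neg_of_neg_of_pos
  · linarith
  · have e : (0 - a.im) ^ 2 = a.im ^ 2 := by ring
    rw [e]
    positivity

/-- The pair term in complex form equals `pairTerm (Re r − Re a) (Im r) (Im a)`. -/
theorem im_pair_eq (a r : ℂ) :
    (1 / (a - r)).im + (1 / (a - conj r)).im = pairTerm (r.re - a.re) r.im a.im := by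
  rw [im_one_div_sub, im_one_div_sub]
  simp only [Complex.conj_re, Complex.conj_im, pairTerm]
  have e2 : (-r.im - a.im) ^ 2 = (r.im + a.im) ^ 2 := by ring
  rw [e2]

/-- ★ The pair term of a zero honouring `NoTallerToucher`ʼs inequality is NEGATIVE. -/
theorem im_pair_neg {a r : ℂ} (ha : 0 < a.im) (hr : 0 < r.im) (hra : r ≠ a)
    (hN : a.im < r.im → a.im + r.im < |a.re - r.re|) :
    (1 / (a - r)).im + (1 / (a - conj r)).im < 0 := by
  rw [im_pair_eq]
  apply pairTerm_neg ha hr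
  apply cap_of_noTallerToucher ha hr
  · rintro ⟨hp, hy⟩
    apply hra
    apply Complex.ext
    · linarith
    · exact hy
  · intro h
    have := hN h
    rwa [show |a.re - r.re| = |r.re - a.re| from abs_sub_comm _ _] at this

/-- The same, with the hypothesis read off `NoTallerToucher f j a` for a zero `r` of `f^{(j)}`. -/
theorem im_pair_neg_of_noTallerToucher {f : ℂ → ℂ} {j : ℕ} {a r : ℂ} (hN : NoTallerToucher f j a) (ha : 0 < a.im)
    (hr0 : iteratedDeriv j f r = 0) (hr : 0 < r.im) (hra : r ≠ a) :
    (1 / (a - r)).im + (1 / (a - conj r)).im < 0 :=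
  im_pair_neg ha hr hra (fun h => hN r hr0 h)

/-! ## §4 The model inequality (finite zero set) -/

/-- ★★ LINK START IN THE MODEL (PROVED): if the link residue has the partial-fraction value over a finite conjugate-closed zero set
`{a, ā} ∪ Z ∪ conj Z ∪ T` honouring `NoTallerToucher`, then `Im h₀ ≤ −1/(2·Im a)`. -/
theorem linkStart_model {f : ℂ → ℂ} {j : ℕ} {a : ℂ} (ha : 0 < a.im) (hN : NoTallerToucher f j a)
    (Z : Finset ℂ) (hZ : ∀ r ∈ Z, iteratedDeriv j f r = 0 ∧ 0 < r.im ∧ r ≠ a) (T : Finset ℝ) :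
    (1 / (a - conj a)).im + (∑ r ∈ Z, ((1 / (a - r)).im + (1 / (a - conj r)).im)) + ∑ t ∈ T, (1 / (a - (t : ℂ))).im
      ≤ -1 / (2 * a.im) := by
  rw [im_inv_sub_conj_self a ha]
  have hZs : ∑ r ∈ Z, ((1 / (a - r)).im + (1 / (a - conj r)).im) ≤ 0 :=
    Finset.sum_nonpos fun r hr => (im_pair_neg_of_noTallerToucher hN ha (hZ r hr).1 (hZ r hr).2.1 (hZ r hr).2.2).le
  have hTs : ∑ t ∈ T, (1 / (a - (t : ℂ))).im ≤ 0 :=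
    Finset.sum_nonpos fun t _ => (im_inv_sub_real_neg a t ha).le
  linarith

/-- … STRICT as soon as there is any other zero (a pair or a tooth): the lone pair is the only equality case. -/
theorem linkStart_model_strict {f : ℂ → ℂ} {j : ℕ} {a : ℂ} (ha : 0 < a.im) (hN : NoTallerToucher f j a)
    (Z : Finset ℂ) (hZ : ∀ r ∈ Z, iteratedDeriv j f r = 0 ∧ 0 < r.im ∧ r ≠ a) (T : Finset ℝ) (hne : Z.Nonempty ∨ T.Nonempty) :
    (1 / (a - conj a)).im + (∑ r ∈ Z, ((1 / (a - r)).im + (1 / (a - conj r)).im)) + ∑ t ∈ T, (1 / (a - (t : ℂ))).im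
      < -1 / (2 * a.im) := by
  rw [im_inv_sub_conj_self a ha]
  have hZs : ∑ r ∈ Z, ((1 / (a - r)).im + (1 / (a - conj r)).im) ≤ 0 :=
    Finset.sum_nonpos fun r hr => (im_pair_neg_of_noTallerToucher hN ha (hZ r hr).1 (hZ r hr).2.1 (hZ r hr).2.2).le
  have hTs : ∑ t ∈ T, (1 / (a - (t : ℂ))).im ≤ 0 :=
    Finset.sum_nonpos fun t _ => (im_inv_sub_real_neg a t ha).le
  rcases hne with ⟨r, hr⟩ | ⟨t, ht⟩
  · have : ∑ r ∈ Z, ((1 / (a - r)).im + (1 / (a - conj r)).im) < 0 :=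
      Finset.sum_neg (fun r hr => im_pair_neg_of_noTallerToucher hN ha (hZ r hr).1 (hZ r hr).2.1 (hZ r hr).2.2) ⟨r, hr⟩
    linarith
  · have : ∑ t ∈ T, (1 / (a - (t : ℂ))).im < 0 :=
      Finset.sum_neg (fun t _ => im_inv_sub_real_neg a t ha) ⟨t, ht⟩
    linarith

/-- The model inequality in the lawʼs currency: residue value `h₀` ⇒ `2·Im h₀ ≤ −1/Im a`. -/
theorem two_mul_im_le_of_model {f : ℂ → ℂ} {j : ℕ} {a h₀ : ℂ} (ha : 0 < a.im) (hN : NoTallerToucher f j a)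
    (Z : Finset ℂ) (hZ : ∀ r ∈ Z, iteratedDeriv j f r = 0 ∧ 0 < r.im ∧ r ≠ a) (T : Finset ℝ)
    (hh : h₀ = 1 / (a - conj a) + (∑ r ∈ Z, (1 / (a - r) + 1 / (a - conj r))) + ∑ t ∈ T, 1 / (a - (t : ℂ))) :
    2 * h₀.im ≤ -1 / a.im := by
  have e : h₀.im = (1 / (a - conj a)).im + (∑ r ∈ Z, ((1 / (a - r)).im + (1 / (a - conj r)).im))
      + ∑ t ∈ T, (1 / (a - (t : ℂ))).im := by
    rw [hh]; simp only [Complex.add_im, Complex.im_sum]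
  have h := linkStart_model ha hN Z hZ T
  rw [← e] at h
  have key : 2 * (-1 / (2 * a.im)) = -1 / a.im := by
    field_simp
  linarith [h, key]

/-- A taller TOUCHER can make its pair term POSITIVE (the chains then leave the disc at second order): `a = i`, `r = 1/2 + (3/2)i` gives
pair term `8/13 > 0` — so `NoTallerToucher` is where the link starts. -/
theorem pairTerm_pos_example : 0 < pairTerm (1 / 2) (3 / 2) 1 := by
  unfold pairTerm; norm_num

end RhW08.Lens1ArcSign


/-!
# TiltedLandingLaw421R3 — lens-1 (part Q): the LINK START LAW is a THEOREM; Jensen containment of the positive face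

LENS-1 gen-8 module image `rh33346-cover/lens-1/JensenLink-v1.lean` (landing target `…/Theorems/TiltedLandingLaw421R3Lens1ArcSignQ.lean`; ONE import =
part P `…R3Lens1ArcSignP` (whose OPEN law it proves); namespace `RhW08.Lens1ArcSign`; 0 `sorry`; checked BY CHAIN over the tree part M with N and P
inlined).

§1–§2 ★★★ `linkStartLaw : LinkStartLawQ` — part Pʼs typed law PROVED: on a legal frame, at a SIMPLE upper zero `a` of `G = f^{(j)}` with
`NoTallerToucher f j a`, `Im(G″(a)/G′(a)) ≤ −1/Im a`; i.e. `2·Im h₀ ≤ −1/Im a` for the link residue `h₀ = G″(a)/(2G′(a))`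
(`two_mul_linkResidue_im_le`), so BOTH nodal chains of `Im(G′/G)` out of `a` enter aʼs Jensen disc at second order.  PROOF (no Hadamard expansion
needed — the treeʼs APPROXIMATE partial fractions suffice): remove the pair, `G = pairQ (Re a) (Im a) · h` (`RhW08.NestedSign.exists_cofactor`, `h` real
entire of order `< 2`, `h a ≠ 0` by simplicity); then `G′(a) = 2(a − Re a)·h(a)`, `G″(a) = 2h(a) + 4(a − Re a)·h′(a)`, so
`G″(a)/G′(a) = 1/(a − Re a) + 2h′(a)/h(a)` and `Im(1/(a − Re a)) = −1/Im a`; finally `Im a · Im(h′/h)(a) ≤ 0` by the treeʼs JENSEN SIGN LEMMA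
(`RhW08.NestedSign.im_mul_im_logDeriv_nonpos`) because `a` is strictly outside the Jensen disc of every zero of `h` — for zeros of height `≤ Im a` this is
automatic (`|Im z|² < (Re a − Re z)² + Im a²` unless `z ∈ {a, ā}`), for taller zeros (or their conjugates) it is exactly `NoTallerToucher`
(`im_sq_lt_of_otherZero`).  STRICT form `linkStart_strict_of_realEntireLt2` (`<` as soon as `f^{(j)}` has a zero other than `a, ā`, via the treeʼs
`im_mul_im_logDeriv_neg`) — the lone pair is the only equality case, as in the finite model of part P.
§3 ★ JENSEN CONTAINMENT (`im_phi_neg_of_jensenClear`, `exists_jensenDisc_of_im_nonneg`, `exists_nonNestedDisc_of_exit`): at an upper point strictly outside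
every Jensen disc `Im(G′/G) < 0`; hence every upper point of the CLOSED positive face `{Im(G′/G) ≥ 0}` — in particular every point of a nodal chain — lies in
the closed Jensen disc of some non-real zero, and a point of the face OUTSIDE aʼs closed disc lies in the disc of a zero `r ∉ {a, ā}` whose disc is NOT
nested in aʼs (`Im a < |Re a − Re r| + |Im r|`: a CROSSING or EXTERIOR zero; under `NoTallerToucher` never a taller one near `a`).  READING for the link
(`TopLinkLawQ`, part N): a chain of `∂F_a` can leave aʼs closed Jensen disc only INTO the outer lune of a crossing / exterior-overlapping lower zero — the
exact event C6ʼs LINK TRACE records as XC/XD; with no such zero the disc clause of `HalfLink` is automatic.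
NOT claimed: `TopLinkLawQ` / `AtomicLinkLawQ` (global), any atomic law, `TopPinning`.  Nothing here bears on the truth of RH; RH is not proved; 33346/33347 OPEN.
-/

noncomputable section

namespace RhW08.Lens1ArcSign

open Complex Set Metric Filter Topology
open scoped Real ComplexConjugate
open Literature.Topology.PlaneTopology Literature.Analysis.Complex
open Summit.RiemannHypothesis.RiemannHypothesis.Theorems.Splittings.JensenWindow
open RhIdea6.G17.W07C7 RhIdea6.G17.W07C7.Rev6 RhIdea6.G18.W07C8.Law421BirthS RhIdea6.G19.W07C11.Seam
open RhIdea6.G20.W07C12.Frac RhIdea6.G20.W07C12.StColP RhW07.C12.FieldSplit RhIdea6.G21.W07C13.TentMax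
open RhW07.C14.TwoSided RhW07.C14.Classes RhW07.C14.Lineage RhW07.C14.Booking
open RhW07.C13.Heredity RhIdea6.G22.W07C15pre.Injection RhW07.E3.Cell RhW07.E3.Lit
open RhW08.Round1 RhW08.StSwap RhW08.Round2 RhW08.QuadW RhW08.SealSwapQ RhW08.SealSwap RhW08.SuccB RhW08.SuccSplit
open RhW08.SuccTheft RhW08.Column RhW08.Hurwitz RhW08.ClusterQ RhW08.ClusterQM RhW08.NewtonDoor RhW08.NewtonDoorGenusOne RhW08.PurseP
open RhW08.Lens1SignCut RhW08.Lens1Coverage RhW08.IsolatedTilt RhW08.Lens1Pinning RhW08.Lens1PinningIso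


/-! ## §1 Jensen-clearness of a simple top among the other zeros -/

/-- Under `NoTallerToucher f j a` (`0 < Im a`, `f^{(j)}` real entire of order `< 2`), every zero `z ∉ {a, ā}` of `f^{(j)}` has `a` strictly outside its
Jensen disc: `Im z² < (Re a − Re z)² + Im a²` (height `≤ Im a`: automatic; taller `z` or `z̄`: the separation clause). -/
theorem im_sq_lt_of_otherZero {f : ℂ → ℂ} {j : ℕ} {a z : ℂ} (hG : RealEntireLt2 (iteratedDeriv j f)) (hN : NoTallerToucher f j a)
    (ha : 0 < a.im) (hz : iteratedDeriv j f z = 0) (hza : z ≠ a) (hzb : z ≠ conj a) :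
    z.im ^ 2 < (a.re - z.re) ^ 2 + a.im ^ 2 := by
  have hΔ : 0 ≤ (a.re - z.re) ^ 2 := sq_nonneg _
  by_cases h1 : a.im < z.im
  · have h := hN z hz h1
    have hlt : z.im < |a.re - z.re| := by linarith
    have key : z.im ^ 2 < |a.re - z.re| ^ 2 := sq_lt_sq' (by linarith [abs_nonneg (a.re - z.re)]) hlt
    rw [sq_abs] at key
    nlinarith
  by_cases h2 : z.im < -a.im
  · have hz' : iteratedDeriv j f (conj z) = 0 := by rw [apply_conj_eq_conj hG.diff hG.real, hz, map_zero]
    have him : a.im < (conj z).im := by rw [Complex.conj_im]; linarith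
    have h := hN (conj z) hz' him
    rw [Complex.conj_re, Complex.conj_im] at h
    have key : z.im ^ 2 < |a.re - z.re| ^ 2 := sq_lt_sq' (by linarith) (by linarith [abs_nonneg (a.re - z.re)])
    rw [sq_abs] at key
    nlinarith
  push Not at h1 h2
  by_cases h3 : z.re = a.re
  · have h4 : z.im ≠ a.im := fun h => hza (Complex.ext h3 h)
    have h5 : z.im ≠ -a.im := by
      intro h
      apply hzb
      apply Complex.ext
      · rw [Complex.conj_re, h3]
      · rw [Complex.conj_im, h]
    have h6 : z.im < a.im := lt_of_le_of_ne h1 h4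
    have h7 : -a.im < z.im := lt_of_le_of_ne h2 (Ne.symm h5)
    nlinarith [mul_pos (sub_pos.2 h6) (show 0 < a.im + z.im by linarith)]
  · have h8 : a.re - z.re ≠ 0 := fun h => h3 (by linarith)
    have h9 : 0 < (a.re - z.re) ^ 2 := by positivity
    nlinarith [mul_nonneg (sub_nonneg.2 h1) (show 0 ≤ a.im + z.im by linarith)]

/-- The same as a Jensen-disc statement: `|Im z| < ‖a − Re z‖`. -/
theorem abs_im_lt_norm_of_otherZero {f : ℂ → ℂ} {j : ℕ} {a z : ℂ} (hG : RealEntireLt2 (iteratedDeriv j f)) (hN : NoTallerToucher f j a)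
    (ha : 0 < a.im) (hz : iteratedDeriv j f z = 0) (hza : z ≠ a) (hzb : z ≠ conj a) :
    |z.im| < ‖a - (z.re : ℂ)‖ := by
  have hsq := im_sq_lt_of_otherZero hG hN ha hz hza hzb
  have e : ‖a - (z.re : ℂ)‖ ^ 2 = (a.re - z.re) ^ 2 + a.im ^ 2 := by
    rw [← Complex.normSq_eq_norm_sq, Complex.normSq_apply]; simp; ring
  have h2 : |z.im| ^ 2 < ‖a - (z.re : ℂ)‖ ^ 2 := by rw [sq_abs, e]; exact hsq
  exact lt_of_pow_lt_pow_left₀ 2 (norm_nonneg _) h2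

/-! ## §2 the LINK START LAW proved -/

/-- PAIR REMOVAL AT A SIMPLE TOP: `f^{(j)} = pairQ (Re a) (Im a) · h` with `h` real entire of order `< 2`, `h a ≠ 0`, `a` strictly outside every Jensen disc
of `h`, and `f^{(j+2)}(a)/f^{(j+1)}(a) = 1/(a − Re a) + 2·h′(a)/h(a)`. -/
theorem linkStart_cofactor {f : ℂ → ℂ} (hf : RealEntireLt2 f) (j : ℕ) {a : ℂ} (ha : iteratedDeriv j f a = 0) (hapos : 0 < a.im)
    (hN : NoTallerToucher f j a) (hsimp : iteratedDeriv (j + 1) f a ≠ 0) :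
    ∃ h : ℂ → ℂ, Differentiable ℂ h ∧ (∃ ρ C : ℝ, 0 ≤ ρ ∧ ρ < 2 ∧ ∀ z, ‖h z‖ ≤ C * Real.exp (‖z‖ ^ ρ)) ∧ (∀ x : ℝ, (h x).im = 0) ∧
      h a ≠ 0 ∧ (∀ z, iteratedDeriv j f z = pairQ a.re a.im z * h z) ∧ (∀ z, h z = 0 → |z.im| < ‖a - (z.re : ℂ)‖) ∧
      iteratedDeriv (j + 2) f a / iteratedDeriv (j + 1) f a = (a - (a.re : ℂ))⁻¹ + (deriv h a / h a + deriv h a / h a) := by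
  have hG : RealEntireLt2 (iteratedDeriv j f) := RhW08.WindowLoss.realEntireLt2_iteratedDeriv hf j
  obtain ⟨h, hhd, hgrow, hreal, hfac⟩ := RhW08.NestedSign.exists_cofactor hG ha hapos.ne'
  have eG : iteratedDeriv j f = pairQ a.re a.im * h := funext fun u => by rw [Pi.mul_apply]; exact hfac u
  have hq : ∀ z, HasDerivAt (pairQ a.re a.im) (2 * (z - a.re)) z :=
    fun z => RhW07.Law421.SuccessorCertificate.hasDerivAt_quadP a.re a.im z
  have hderiv : ∀ z, deriv (iteratedDeriv j f) z = 2 * (z - a.re) * h z + pairQ a.re a.im z * deriv h z := by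
    intro z
    have hp := (hq z).mul (hhd z).hasDerivAt
    rw [eG, hp.deriv]
  have hhd' : Differentiable ℂ (deriv h) :=
    Summit.RiemannHypothesis.RiemannHypothesis.Theorems.Splittings.JensenWindow.differentiable_deriv hhd
  have hderiv2 : ∀ z, deriv (deriv (iteratedDeriv j f)) z =
      2 * h z + 4 * (z - a.re) * deriv h z + pairQ a.re a.im z * deriv (deriv h) z := by
    intro z
    have eG' : deriv (iteratedDeriv j f) = (fun z : ℂ => 2 * (z - a.re)) * h + pairQ a.re a.im * deriv h :=
      funext fun u => by simp only [Pi.add_apply, Pi.mul_apply]; exact hderiv u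
    have hlin : HasDerivAt (fun z : ℂ => 2 * (z - a.re)) 2 z := by
      have h0 := ((hasDerivAt_id z).sub_const (a.re : ℂ)).const_mul (2 : ℂ)
      simpa using h0
    have hp := (hlin.mul (hhd z).hasDerivAt).add ((hq z).mul (hhd' z).hasDerivAt)
    rw [eG', hp.deriv]
    ring
  have hs1 : iteratedDeriv (j + 1) f = deriv (iteratedDeriv j f) := iteratedDeriv_succ
  have hs2 : iteratedDeriv (j + 2) f = deriv (deriv (iteratedDeriv j f)) := by
    rw [show j + 2 = j + 1 + 1 from rfl, iteratedDeriv_succ, hs1]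
  have e1 : a - (a.re : ℂ) = (a.im : ℂ) * I := by apply Complex.ext <;> simp
  have hqa : pairQ a.re a.im a = 0 := by
    rw [pairQ, e1, mul_pow, Complex.I_sq]; ring
  have hha : h a ≠ 0 := by
    intro h0; apply hsimp; rw [hs1, hderiv a, h0, hqa]; simp
  have hhabar : h (conj a) ≠ 0 := by rw [apply_conj_eq_conj hhd hreal, map_ne_zero]; exact hha
  have hzero : ∀ z, h z = 0 → iteratedDeriv j f z = 0 := fun z hz => by rw [hfac z, hz, mul_zero]
  have hout : ∀ z, h z = 0 → |z.im| < ‖a - (z.re : ℂ)‖ := by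
    intro z hz
    have hza : z ≠ a := by rintro rfl; exact hha hz
    have hzb : z ≠ conj a := by rintro rfl; exact hhabar hz
    exact abs_im_lt_norm_of_otherZero hG hN hapos (hzero z hz) hza hzb
  have hc : a - (a.re : ℂ) ≠ 0 := by
    rw [e1]; exact mul_ne_zero (Complex.ofReal_ne_zero.2 hapos.ne') Complex.I_ne_zero
  have hG1 : iteratedDeriv (j + 1) f a = 2 * (a - a.re) * h a := by rw [hs1, hderiv a, hqa, zero_mul, add_zero]
  have hG2 : iteratedDeriv (j + 2) f a = 2 * h a + 4 * (a - a.re) * deriv h a := by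
    rw [hs2, hderiv2 a, hqa, zero_mul, add_zero]
  refine ⟨h, hhd, hgrow, hreal, hha, hfac, hout, ?_⟩
  rw [hG1, hG2]
  field_simp
  ring

/-- `Im(1/(a − Re a)) = −1/Im a`. -/
theorem im_inv_sub_re (a : ℂ) (ha : a.im ≠ 0) : ((a - (a.re : ℂ))⁻¹).im = -1 / a.im := by
  have e1 : a - (a.re : ℂ) = (a.im : ℂ) * I := by apply Complex.ext <;> simp
  rw [e1, Complex.inv_im]
  simp [Complex.normSq_apply]
  field_simp

/-- ★★ LINK START for a real entire `f` of order `< 2`: at a SIMPLE upper zero `a` of `f^{(j)}` with `NoTallerToucher f j a`,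
`Im(f^{(j+2)}(a)/f^{(j+1)}(a)) ≤ −1/Im a`. -/
theorem linkStart_of_realEntireLt2 {f : ℂ → ℂ} (hf : RealEntireLt2 f) (j : ℕ) {a : ℂ} (ha : iteratedDeriv j f a = 0) (hapos : 0 < a.im)
    (hN : NoTallerToucher f j a) (hsimp : iteratedDeriv (j + 1) f a ≠ 0) :
    (iteratedDeriv (j + 2) f a / iteratedDeriv (j + 1) f a).im ≤ -1 / a.im := by
  obtain ⟨h, hhd, ⟨ρ, C, hρ0, hρ, hgr⟩, hreal, hha, -, hout, hratio⟩ := linkStart_cofactor hf j ha hapos hN hsimp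
  have hsign := RhW08.NestedSign.im_mul_im_logDeriv_nonpos hhd hρ0 hρ hgr hreal hha hout
  have hKim : (deriv h a / h a).im ≤ 0 := by
    by_contra hp
    push Not at hp
    have := mul_pos hapos hp
    linarith
  rw [hratio, Complex.add_im, Complex.add_im, im_inv_sub_re a hapos.ne']
  linarith

/-- `pairQ (Re a) (Im a) z = (z − a)(z − ā)`; hence it vanishes only at `a, ā`. -/
theorem pairQ_ne_zero_of_ne {a z : ℂ} (hza : z ≠ a) (hzb : z ≠ conj a) : pairQ a.re a.im z ≠ 0 := by
  have e : pairQ a.re a.im z = (z - a) * (z - conj a) := by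
    simp only [pairQ]
    apply Complex.ext
    · simp [sq, Complex.mul_re]; ring
    · simp [sq, Complex.mul_im]; ring
  rw [e]
  exact mul_ne_zero (sub_ne_zero.2 hza) (sub_ne_zero.2 hzb)

/-- ★ STRICT LINK START: if `f^{(j)}` has a zero other than `a, ā`, the inequality is strict (the lone pair is the only equality case). -/
theorem linkStart_strict_of_realEntireLt2 {f : ℂ → ℂ} (hf : RealEntireLt2 f) (j : ℕ) {a : ℂ} (ha : iteratedDeriv j f a = 0) (hapos : 0 < a.im)
    (hN : NoTallerToucher f j a) (hsimp : iteratedDeriv (j + 1) f a ≠ 0)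
    (hex : ∃ z, iteratedDeriv j f z = 0 ∧ z ≠ a ∧ z ≠ conj a) :
    (iteratedDeriv (j + 2) f a / iteratedDeriv (j + 1) f a).im < -1 / a.im := by
  obtain ⟨h, hhd, ⟨ρ, C, hρ0, hρ, hgr⟩, hreal, hha, hfac, hout, hratio⟩ := linkStart_cofactor hf j ha hapos hN hsimp
  obtain ⟨z, hz, hza, hzb⟩ := hex
  have hhz : h z = 0 := by
    have e := hfac z
    rw [hz] at e
    exact (mul_eq_zero.1 e.symm).resolve_left (pairQ_ne_zero_of_ne hza hzb)
  have hclear : JensenClear h a := fun w hw _ => hout w hw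
  have hsign := im_mul_im_logDeriv_neg hhd hρ0 hρ hgr hreal ⟨z, hhz⟩ hapos.ne' hclear
  have hKim : (deriv h a / h a).im < 0 := by
    by_contra hp
    push Not at hp
    have := mul_nonneg hapos.le hp
    linarith
  rw [hratio, Complex.add_im, Complex.add_im, im_inv_sub_re a hapos.ne']
  linarith

/-- ★★★ THE LINK START LAW (part P) IS A THEOREM. -/
theorem linkStartLaw : LinkStartLawQ := by
  intro η f x₀ s hmax R Hs B hE j a ha hapos hN hs
  exact linkStart_of_realEntireLt2 (realEntireLt2_of_hyps hE) j ha hapos hN hs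

/-- Hence unconditionally: `2·Im h₀ ≤ −1/Im a` for the link residue on every legal frame. -/
theorem two_mul_linkResidue_im_le {η : ℝ} {f : ℂ → ℂ} {x₀ s hmax R Hs : ℝ} {B : ℕ} (hE : EngineHyps5 2 η f x₀ s hmax R Hs B) {j : ℕ} {a : ℂ}
    (ha : iteratedDeriv j f a = 0) (hapos : 0 < a.im) (hN : NoTallerToucher f j a) (hs : iteratedDeriv (j + 1) f a ≠ 0) :
    2 * (linkResidue f j a).im ≤ -1 / a.im :=
  linkStartLaw_residue_form linkStartLaw hE ha hapos hN hs

/-! ## §3 Jensen containment of the closed positive face -/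

/-- ★ At an upper point strictly outside the Jensen disc of every non-real zero of `f^{(j)}` (which has at least one zero), `Im(f^{(j+1)}/f^{(j)}) < 0`. -/
theorem im_phi_neg_of_jensenClear {f : ℂ → ℂ} (hf : RealEntireLt2 f) (j : ℕ) {z : ℂ} (hz : 0 < z.im) (hex : ∃ r, iteratedDeriv j f r = 0)
    (hout : ∀ r, iteratedDeriv j f r = 0 → r.im ≠ 0 → |r.im| < ‖z - (r.re : ℂ)‖) :
    (iteratedDeriv (j + 1) f z / iteratedDeriv j f z).im < 0 := by
  have hG : RealEntireLt2 (iteratedDeriv j f) := RhW08.WindowLoss.realEntireLt2_iteratedDeriv hf j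
  obtain ⟨ρ, C, hρ0, hρ, hgr⟩ := hG.growth
  have h := im_mul_im_logDeriv_neg hG.diff hρ0 hρ hgr hG.real hex hz.ne' hout
  rw [← iteratedDeriv_succ] at h
  by_contra hp
  push Not at hp
  have := mul_nonneg hz.le hp
  linarith

/-- ★ JENSEN CONTAINMENT: every upper point of the closed positive face `{Im(f^{(j+1)}/f^{(j)}) ≥ 0}` lies in the CLOSED Jensen disc of some non-real zero. -/
theorem exists_jensenDisc_of_im_nonneg {f : ℂ → ℂ} (hf : RealEntireLt2 f) (j : ℕ) {z : ℂ} (hz : 0 < z.im) (hex : ∃ r, iteratedDeriv j f r = 0)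
    (hpos : 0 ≤ (iteratedDeriv (j + 1) f z / iteratedDeriv j f z).im) :
    ∃ r : ℂ, iteratedDeriv j f r = 0 ∧ r.im ≠ 0 ∧ ‖z - (r.re : ℂ)‖ ≤ |r.im| := by
  by_contra hno
  push Not at hno
  have h := im_phi_neg_of_jensenClear hf j hz hex fun r hr hri => hno r hr hri
  linarith

/-- The closed Jensen disc in coordinates: `‖z − Re r‖ ≤ |Im r| ↔ (Re z − Re r)² + Im z² ≤ Im r²`. -/
theorem norm_sub_re_le_iff (z r : ℂ) : ‖z - (r.re : ℂ)‖ ≤ |r.im| ↔ (z.re - r.re) ^ 2 + z.im ^ 2 ≤ r.im ^ 2 := by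
  have e : ‖z - (r.re : ℂ)‖ ^ 2 = (z.re - r.re) ^ 2 + z.im ^ 2 := by
    rw [← Complex.normSq_eq_norm_sq, Complex.normSq_apply]; simp; ring
  rw [← sq_abs r.im, ← e]
  exact (pow_le_pow_iff_left₀ (norm_nonneg _) (abs_nonneg _) two_ne_zero).symm

/-- ★ EXIT CLASSIFICATION: an upper point of the closed positive face OUTSIDE aʼs closed Jensen disc lies in the closed disc of a zero `r ∉ {a, ā}` whose disc is
NOT nested in aʼs (`Im a < |Re a − Re r| + |Im r|` — a crossing or exterior zero). -/
theorem exists_nonNestedDisc_of_exit {f : ℂ → ℂ} (hf : RealEntireLt2 f) (j : ℕ) {a z : ℂ} (ha : iteratedDeriv j f a = 0) (hz : 0 < z.im)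
    (hpos : 0 ≤ (iteratedDeriv (j + 1) f z / iteratedDeriv j f z).im) (hout : ¬ NestedStep a z) :
    ∃ r : ℂ, iteratedDeriv j f r = 0 ∧ r.im ≠ 0 ∧ r ≠ a ∧ r ≠ conj a ∧ ‖z - (r.re : ℂ)‖ ≤ |r.im| ∧ a.im < |a.re - r.re| + |r.im| := by
  obtain ⟨r, hr, hri, hzr⟩ := exists_jensenDisc_of_im_nonneg hf j hz ⟨a, ha⟩ hpos
  have hzr' := (norm_sub_re_le_iff z r).1 hzr
  have hra : r ≠ a := by
    rintro rfl; exact hout hzr'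
  have hrb : r ≠ conj a := by
    rintro rfl
    rw [Complex.conj_re, Complex.conj_im, neg_sq] at hzr'
    exact hout hzr'
  refine ⟨r, hr, hri, hra, hrb, hzr, ?_⟩
  by_contra hle
  push Not at hle
  have h1 : ‖z - (a.re : ℂ)‖ ≤ ‖z - (r.re : ℂ)‖ + ‖(r.re : ℂ) - (a.re : ℂ)‖ := norm_sub_le_norm_sub_add_norm_sub _ _ _
  have h2 : ‖(r.re : ℂ) - (a.re : ℂ)‖ = |a.re - r.re| := by
    rw [← Complex.ofReal_sub, Complex.norm_real, Real.norm_eq_abs, abs_sub_comm]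
  have h3 : ‖z - (a.re : ℂ)‖ ≤ |a.im| :=
    calc ‖z - (a.re : ℂ)‖ ≤ ‖z - (r.re : ℂ)‖ + ‖(r.re : ℂ) - (a.re : ℂ)‖ := h1
      _ ≤ |r.im| + |a.re - r.re| := by rw [h2]; linarith [hzr]
      _ ≤ a.im := by linarith
      _ ≤ |a.im| := le_abs_self _
  exact hout ((norm_sub_re_le_iff z a).1 h3)

end RhW08.Lens1ArcSign


/-!
# TiltedLandingLaw421R3 — lens-1 (part S): the NEAR CHILD — linearised child in the closed disc (by LINK START) and the Rouché certificate

LENS-1 gen-8 module image `rh33346-cover/lens-1/NearChild-v1.lean` (landing target `…/Theorems/TiltedLandingLaw421R3Lens1ArcSignS.lean`; ONE import =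
part Q `…R3Lens1ArcSignQ`; namespace `RhW08.Lens1ArcSign`; 0 `sorry`; checked BY CHAIN over the tree part M with N, P, Q inlined).

WHAT C6ʼs LINK TRACE SHOWS (LINK-NOTE-C6-g39 8e94c616, 1 163 bank tops, 0 strangled tops): the link is ALWAYS realised by the NEAR CHILD — the zero `w` of
`φ = G′/G` next to the pole `a`, `w ≈ a − 1/φ_reg(a)` with `φ_reg(a) = lim_{z→a} (φ(z) − 1/(z − a)) = G″(a)/(2G′(a))` (median offset .008·Im a), inside the CLOSED Jensen
disc on 1 163/1 163 rows with a thin margin (min .0056·Im a); first-order in-disc number `μ = −2·Im a·Im φ_reg(a) ≥ 3.00`.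
§1 THE LINEARISED CHILD IS ALWAYS IN THE CLOSED DISC — and that is EXACTLY LINK START.  `linChild f j a := a − 2·f⁽ʲ⁺¹⁾(a)/f⁽ʲ⁺²⁾(a)` (= `a − 1/φ_reg(a)`, the zero
of the linearisation `1/(z − a) + φ_reg(a)` of `φ`; twice the Newton step of `G′` at `a`).  Pure algebra (`nestedStep_sub_two_div_iff`): for `c ≠ 0`, `a − 2/c` lies in aʼs
closed Jensen disc ⟺ `Im c ≤ −1/Im a` ⟺ C6ʼs `μ ≥ 1`; and `Im(f⁽ʲ⁺²⁾(a)/f⁽ʲ⁺¹⁾(a)) ≤ −1/Im a` IS part Pʼs `LinkStartLawQ`, PROVED in part Q.  Hence ★★ `nestedStep_linChild`: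
at every simple top with `NoTallerToucher` (real entire, order < 2) the linearised child lies in the CLOSED Jensen disc — on the circle iff `f⁽ʲ⁾` is the lone pair
(`linChild_mem_openDisc` gives the open disc as soon as another zero exists); `deriv2_ne_zero_of_top`: such a top has `f⁽ʲ⁺²⁾(a) ≠ 0`; `linChild_im_lt`: the
linearised child is strictly LOWER than `a`.  (Over all real tilts `g` the linearised children `a − 1/(φ_reg + g)` fill the circle of diameter `[a − i/|Im φ_reg(a)|, a]`,
internally tangent to aʼs Jensen circle at `a` and inside it iff LINK START — the lone pair is the case of equality, whose children are ON the circle.)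
§2 THE ROUCHÉ CERTIFICATE (pure complex analysis over the treeʼs exact-count Rouché theorem `Literature.Analysis.Complex.Rouche.existsUnique_zero_of_norm_sub_lt`):
★★ `exists_crit_near_linChild`: `G` differentiable, `c ≠ 0`, `w₀ := a − 2/c`, `0 < r < ‖2/c‖`, `G ≠ 0` on the closed ball `B̄(w₀, r)`, and on the circle `‖z − w₀‖ = r`
the REGULAR-PART VARIATION is small — `‖(G′(z)/G(z) − (z − a)⁻¹ − c/2)·(z − a)‖ < (‖c‖/2)·r` — ⇒ `G′` has a zero `u` with `‖u − w₀‖ < r` (comparison function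
`G·((z − a)⁻¹ + c/2) = G·c(z − w₀)/(2(z − a))`, whose only zero in the ball is `w₀`, simple).  ★★ `exists_nestedChild_of_roucheCert`: with `c := f⁽ʲ⁺²⁾(a)/f⁽ʲ⁺¹⁾(a)` and the
ball inside aʼs closed disc above the axis (`‖w₀ − Re a‖ + r ≤ Im a`, `r < Im w₀`) the zero is a NON-REAL CHILD with `NestedStep a u` — disjunct 1 of `TopPinning`, row by row,
from ONE explicit inequality on ONE circle (exact/interval arithmetic).  ★ `RoucheCertLawQ` (OPEN, typed; binders of `TopLinkLawQ`): some radius certifies;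
`topPinning_of_roucheCertLaw : RoucheCertLawQ → TopPinning`.  PARTIAL by nature — a price tag and a row-level instrument, like part Rʼs point certificate.  TOY
(`linktoy/rouchecert.py`, model `G = P·e^{gz}`, radius scan τ = r·‖c‖/2 ∈ [.02, .7], 11 tilts per frame): certified (frame, tilt) pairs AT 228/440 · N2 260/440 · N3 222/330 ·
toothed 206/330, rising with the cluster strength `‖c‖·Im a` (< 4: 0 % · [4, 8): ≈ 30 % · ≥ 16: 85–100 %; C6ʼs bank: `‖c‖·Im a = 2|φ_reg(a)|·Im a` ∈ [4.4, 41.6], median 12.6),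
0/916 violations (the true child is within `r` of `w₀` every time); complementary to part R (point certificate: AT 40/60 but N3 8/40 — Rouché is best on N3).
NOT claimed: `RoucheCertLawQ`, `PointCertLawQ`, `TopLinkLawQ`, `TopPinning`.  Nothing here bears on the truth of RH; RH is not proved; 33346/33347 OPEN.
-/

noncomputable section

namespace RhW08.Lens1ArcSign

open Complex Set Metric Filter Topology
open scoped Real ComplexConjugate
open Literature.Topology.PlaneTopology Literature.Analysis.Complex
open Summit.RiemannHypothesis.RiemannHypothesis.Theorems.Splittings.JensenWindow
open RhIdea6.G17.W07C7 RhIdea6.G17.W07C7.Rev6 RhIdea6.G18.W07C8.Law421BirthS RhIdea6.G19.W07C11.Seam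
open RhIdea6.G20.W07C12.Frac RhIdea6.G20.W07C12.StColP RhW07.C12.FieldSplit RhIdea6.G21.W07C13.TentMax
open RhW07.C14.TwoSided RhW07.C14.Classes RhW07.C14.Lineage RhW07.C14.Booking
open RhW07.C13.Heredity RhIdea6.G22.W07C15pre.Injection RhW07.E3.Cell RhW07.E3.Lit
open RhW08.Round1 RhW08.StSwap RhW08.Round2 RhW08.QuadW RhW08.SealSwapQ RhW08.SealSwap RhW08.SuccB RhW08.SuccSplit
open RhW08.SuccTheft RhW08.Column RhW08.Hurwitz RhW08.ClusterQ RhW08.ClusterQM RhW08.NewtonDoor RhW08.NewtonDoorGenusOne RhW08.PurseP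
open RhW08.Lens1SignCut RhW08.Lens1Coverage RhW08.IsolatedTilt RhW08.Lens1Pinning RhW08.Lens1PinningIso


/-! ## §1 the linearised child and LINK START -/

/-- Pure algebra: for `c ≠ 0`, the point `a − 2/c` lies in aʼs CLOSED Jensen disc iff `Im a · Im c ≤ −1`. -/
theorem nestedStep_sub_two_div_iff {a c : ℂ} (hc : c ≠ 0) : NestedStep a (a - 2 / c) ↔ a.im * c.im ≤ -1 := by
  have hn : 0 < Complex.normSq c := Complex.normSq_pos.2 hc
  have hnq : Complex.normSq c = c.re * c.re + c.im * c.im := Complex.normSq_apply c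
  have hre : (a - 2 / c).re - a.re = -(2 * c.re / Complex.normSq c) := by
    rw [Complex.sub_re, Complex.div_re]; simp
  have him : (a - 2 / c).im = a.im + 2 * c.im / Complex.normSq c := by
    rw [Complex.sub_im, Complex.div_im]; simp
  unfold NestedStep
  rw [hre, him]
  have key : (-(2 * c.re / Complex.normSq c)) ^ 2 + (a.im + 2 * c.im / Complex.normSq c) ^ 2 - a.im ^ 2 =
      4 / Complex.normSq c * (1 + a.im * c.im) := by
    field_simp
    rw [hnq]; ring
  constructor
  · intro h
    have h4 : 4 / Complex.normSq c * (1 + a.im * c.im) ≤ 0 := by rw [← key]; linarith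
    have hpos : 0 < 4 / Complex.normSq c := by positivity
    rcases le_or_gt (a.im * c.im) (-1) with h' | h'
    · exact h'
    · have := mul_pos hpos (by linarith : 0 < 1 + a.im * c.im)
      linarith
  · intro h
    have h4 : 4 / Complex.normSq c * (1 + a.im * c.im) ≤ 0 :=
      mul_nonpos_of_nonneg_of_nonpos (by positivity) (by linarith)
    rw [← key] at h4; linarith

/-- … in particular `Im c ≤ −1/Im a` (the shape of `LinkStartLawQ`ʼs conclusion) puts `a − 2/c` in the closed disc. -/
theorem nestedStep_sub_two_div {a c : ℂ} (ha : 0 < a.im) (hc : c.im ≤ -1 / a.im) : NestedStep a (a - 2 / c) := by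
  have hcim : c.im < 0 := lt_of_le_of_lt hc (by rw [neg_div]; exact neg_neg_of_pos (one_div_pos.2 ha))
  have hc0 : c ≠ 0 := fun h => by rw [h, Complex.zero_im] at hcim; exact lt_irrefl _ hcim
  rw [nestedStep_sub_two_div_iff hc0]
  have := (le_div_iff₀ ha).1 hc
  linarith [this]

/-- Strict version: `Im c < −1/Im a` puts `a − 2/c` in the OPEN disc. -/
theorem mem_openDisc_sub_two_div {a c : ℂ} (ha : 0 < a.im) (hc : c.im < -1 / a.im) :
    ((a - 2 / c).re - a.re) ^ 2 + (a - 2 / c).im ^ 2 < a.im ^ 2 := by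
  have hcim : c.im < 0 := lt_trans hc (by rw [neg_div]; exact neg_neg_of_pos (one_div_pos.2 ha))
  have hc0 : c ≠ 0 := fun h => by rw [h, Complex.zero_im] at hcim; exact lt_irrefl _ hcim
  have hn : 0 < Complex.normSq c := Complex.normSq_pos.2 hc0
  have hnq : Complex.normSq c = c.re * c.re + c.im * c.im := Complex.normSq_apply c
  have hre : (a - 2 / c).re - a.re = -(2 * c.re / Complex.normSq c) := by
    rw [Complex.sub_re, Complex.div_re]; simp
  have him : (a - 2 / c).im = a.im + 2 * c.im / Complex.normSq c := by
    rw [Complex.sub_im, Complex.div_im]; simp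
  rw [hre, him]
  have key : (-(2 * c.re / Complex.normSq c)) ^ 2 + (a.im + 2 * c.im / Complex.normSq c) ^ 2 - a.im ^ 2 =
      4 / Complex.normSq c * (1 + a.im * c.im) := by
    field_simp
    rw [hnq]; ring
  have hlt : a.im * c.im < -1 := by have := (lt_div_iff₀ ha).1 hc; linarith
  have h4 : 4 / Complex.normSq c * (1 + a.im * c.im) < 0 := mul_neg_of_pos_of_neg (by positivity) (by linarith)
  rw [← key] at h4; linarith

/-- The LINEARISED CHILD of a zero `a` of `f^{(j)}`: `a − 2·f^{(j+1)}(a)/f^{(j+2)}(a) = a − 1/φ_reg(a)`, the zero of the linearisation `1/(z − a) + φ_reg(a)` of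
`φ = f^{(j+1)}/f^{(j)}` at its pole `a` (C6ʼs `a − 1/φ_reg(a)`; twice the Newton step of `f^{(j+1)}` at `a`). -/
def linChild (f : ℂ → ℂ) (j : ℕ) (a : ℂ) : ℂ := a - 2 * iteratedDeriv (j + 1) f a / iteratedDeriv (j + 2) f a

/-- A simple top with `NoTallerToucher` has `f^{(j+2)}(a) ≠ 0` (since `Im(f^{(j+2)}(a)/f^{(j+1)}(a)) ≤ −1/Im a < 0`). -/
theorem deriv2_ne_zero_of_top {f : ℂ → ℂ} (hf : RealEntireLt2 f) (j : ℕ) {a : ℂ} (ha : iteratedDeriv j f a = 0) (hapos : 0 < a.im)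
    (hN : NoTallerToucher f j a) (hsimp : iteratedDeriv (j + 1) f a ≠ 0) : iteratedDeriv (j + 2) f a ≠ 0 := by
  intro h0
  have h := linkStart_of_realEntireLt2 hf j ha hapos hN hsimp
  rw [h0, zero_div, Complex.zero_im] at h
  have : 0 < 1 / a.im := one_div_pos.2 hapos
  rw [neg_div] at h; linarith

/-- `linChild = a − 2/c` with `c = f^{(j+2)}(a)/f^{(j+1)}(a)`. -/
theorem linChild_eq {f : ℂ → ℂ} (j : ℕ) {a : ℂ} (hsimp : iteratedDeriv (j + 1) f a ≠ 0) (h2 : iteratedDeriv (j + 2) f a ≠ 0) :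
    linChild f j a = a - 2 / (iteratedDeriv (j + 2) f a / iteratedDeriv (j + 1) f a) := by
  unfold linChild
  congr 1
  field_simp

/-- ★★ THE LINEARISED CHILD IS IN THE CLOSED JENSEN DISC at every simple top with `NoTallerToucher` (real entire, order `< 2`) — by LINK START (part Q). -/
theorem nestedStep_linChild {f : ℂ → ℂ} (hf : RealEntireLt2 f) (j : ℕ) {a : ℂ} (ha : iteratedDeriv j f a = 0) (hapos : 0 < a.im)
    (hN : NoTallerToucher f j a) (hsimp : iteratedDeriv (j + 1) f a ≠ 0) : NestedStep a (linChild f j a) := by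
  rw [linChild_eq j hsimp (deriv2_ne_zero_of_top hf j ha hapos hN hsimp)]
  exact nestedStep_sub_two_div hapos (linkStart_of_realEntireLt2 hf j ha hapos hN hsimp)

/-- … and in the OPEN disc as soon as `f^{(j)}` has a zero other than `a, ā`. -/
theorem linChild_mem_openDisc {f : ℂ → ℂ} (hf : RealEntireLt2 f) (j : ℕ) {a : ℂ} (ha : iteratedDeriv j f a = 0) (hapos : 0 < a.im)
    (hN : NoTallerToucher f j a) (hsimp : iteratedDeriv (j + 1) f a ≠ 0) (hex : ∃ z, iteratedDeriv j f z = 0 ∧ z ≠ a ∧ z ≠ conj a) :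
    ((linChild f j a).re - a.re) ^ 2 + (linChild f j a).im ^ 2 < a.im ^ 2 := by
  rw [linChild_eq j hsimp (deriv2_ne_zero_of_top hf j ha hapos hN hsimp)]
  exact mem_openDisc_sub_two_div hapos (linkStart_strict_of_realEntireLt2 hf j ha hapos hN hsimp hex)

/-- The linearised child is strictly LOWER than `a`: `Im(a − 2/c) < Im a` whenever `Im c < 0`. -/
theorem im_sub_two_div_lt {a c : ℂ} (hc : c.im < 0) : (a - 2 / c).im < a.im := by
  have hc0 : c ≠ 0 := fun h => by rw [h, Complex.zero_im] at hc; exact lt_irrefl _ hc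
  have hn : 0 < Complex.normSq c := Complex.normSq_pos.2 hc0
  have him : (a - 2 / c).im = a.im + 2 * c.im / Complex.normSq c := by
    rw [Complex.sub_im, Complex.div_im]; simp
  rw [him]
  have : 2 * c.im / Complex.normSq c < 0 := div_neg_of_neg_of_pos (by linarith) hn
  linarith

/-- … at a simple top with `NoTallerToucher`: `Im (linChild f j a) < Im a`. -/
theorem linChild_im_lt {f : ℂ → ℂ} (hf : RealEntireLt2 f) (j : ℕ) {a : ℂ} (ha : iteratedDeriv j f a = 0) (hapos : 0 < a.im)
    (hN : NoTallerToucher f j a) (hsimp : iteratedDeriv (j + 1) f a ≠ 0) : (linChild f j a).im < a.im := by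
  rw [linChild_eq j hsimp (deriv2_ne_zero_of_top hf j ha hapos hN hsimp)]
  refine im_sub_two_div_lt (lt_of_le_of_lt (linkStart_of_realEntireLt2 hf j ha hapos hN hsimp) ?_)
  rw [neg_div]; exact neg_neg_of_pos (one_div_pos.2 hapos)

/-! ## §2 the Rouché certificate for the near child -/

/-- The comparison function's factor: `(z − a)⁻¹ + c/2 = c·(z − (a − 2/c))/(2(z − a))` for `z ≠ a`, `c ≠ 0`. -/
theorem inv_add_half_eq {a c z : ℂ} (hc : c ≠ 0) (hz : z ≠ a) : (z - a)⁻¹ + c / 2 = c * (z - (a - 2 / c)) / (2 * (z - a)) := by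
  have hza : z - a ≠ 0 := sub_ne_zero.2 hz
  field_simp
  ring

/-- ★★ ROUCHÉ FOR THE NEAR CHILD: `G` differentiable, `c ≠ 0`, `w₀ = a − 2/c`, `0 < r < ‖2/c‖` (so `a` is outside the closed ball `B̄(w₀, r)`), `G ≠ 0` on that closed ball,
and on the circle `‖z − w₀‖ = r` the regular-part variation is small: `‖(G′ z/G z − (z − a)⁻¹ − c/2)·(z − a)‖ < (‖c‖/2)·r` ⇒ `G′` has a zero `u` with `‖u − w₀‖ < r`. -/
theorem exists_crit_near_linChild {G : ℂ → ℂ} (hG : Differentiable ℂ G) {a c : ℂ} (hc : c ≠ 0) {r : ℝ} (hr : 0 < r) (hr2 : r < ‖2 / c‖)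
    (hG0 : ∀ z, ‖z - (a - 2 / c)‖ ≤ r → G z ≠ 0)
    (hsmall : ∀ z, ‖z - (a - 2 / c)‖ = r → ‖(deriv G z / G z - (z - a)⁻¹ - c / 2) * (z - a)‖ < ‖c‖ / 2 * r) :
    ∃ u : ℂ, ‖u - (a - 2 / c)‖ < r ∧ deriv G u = 0 := by
  set w₀ : ℂ := a - 2 / c with hw₀
  -- `a` is not in the open ball `ball w₀ ‖2/c‖`
  have haw : ‖a - w₀‖ = ‖2 / c‖ := by rw [hw₀, sub_sub_cancel]
  have hne_a : ∀ z ∈ ball w₀ ‖2 / c‖, z ≠ a := by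
    intro z hz hza
    rw [mem_ball, dist_eq_norm, hza, haw] at hz
    exact lt_irrefl _ hz
  set g : ℂ → ℂ := fun z => G z * ((z - a)⁻¹ + c / 2) with hg
  have hginv : DifferentiableOn ℂ (fun z : ℂ => (z - a)⁻¹ + c / 2) (ball w₀ ‖2 / c‖) := by
    intro z hz
    have hza : z - a ≠ 0 := sub_ne_zero.2 (hne_a z hz)
    exact (((differentiableAt_id.sub_const a).inv hza).add_const (c / 2)).differentiableWithinAt
  have hgd : DifferentiableOn ℂ g (ball w₀ ‖2 / c‖) := (hG.differentiableOn).mul hginv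
  have hfd : DifferentiableOn ℂ (deriv G) (ball w₀ ‖2 / c‖) := (differentiable_deriv hG).differentiableOn
  -- Rouché inequality on the circle
  have hR : ∀ z : ℂ, ‖z - w₀‖ = r → ‖deriv G z - g z‖ < ‖g z‖ := by
    intro z hz
    have hzball : z ∈ ball w₀ ‖2 / c‖ := by rw [mem_ball, dist_eq_norm, hz]; exact hr2
    have hza : z ≠ a := hne_a z hzball
    have hza' : z - a ≠ 0 := sub_ne_zero.2 hza
    have hGz : G z ≠ 0 := hG0 z hz.le
    have hfac : (z - a)⁻¹ + c / 2 = c * (z - w₀) / (2 * (z - a)) := by rw [hw₀]; exact inv_add_half_eq hc hza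
    have hnormq : ‖(z - a)⁻¹ + c / 2‖ = ‖c‖ / 2 * r / ‖z - a‖ := by
      rw [hfac, norm_div, norm_mul, norm_mul, hz, Complex.norm_two]; ring
    have hgz : g z = G z * ((z - a)⁻¹ + c / 2) := rfl
    have h1 : deriv G z - g z = G z * ((deriv G z / G z - (z - a)⁻¹ - c / 2) * (z - a)) / (z - a) := by
      rw [hgz]; field_simp; ring
    rw [h1, norm_div, norm_mul (G z) ((deriv G z / G z - (z - a)⁻¹ - c / 2) * (z - a)), hgz,
      norm_mul (G z) ((z - a)⁻¹ + c / 2), hnormq]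
    have hGpos : 0 < ‖G z‖ := norm_pos_iff.2 hGz
    have hzapos : 0 < ‖z - a‖ := norm_pos_iff.2 hza'
    rw [div_lt_iff₀ hzapos, show ‖G z‖ * (‖c‖ / 2 * r / ‖z - a‖) * ‖z - a‖ = ‖G z‖ * (‖c‖ / 2 * r) by field_simp]
    exact mul_lt_mul_of_pos_left (hsmall z hz) hGpos
  -- the comparison function has the unique simple zero w₀ in the closed ball
  have hw₀mem : w₀ ∈ closedBall w₀ r := mem_closedBall_self hr.le
  have hw₀a : w₀ ≠ a := hne_a w₀ (mem_ball_self (lt_trans hr hr2))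
  have hw₀a' : w₀ - a ≠ 0 := sub_ne_zero.2 hw₀a
  have hq0 : (w₀ - a)⁻¹ + c / 2 = 0 := by
    rw [hw₀]
    have : a - 2 / c - a = -(2 / c) := by ring
    rw [this, inv_neg, inv_div]; ring
  have hg0 : g w₀ = 0 := by show G w₀ * ((w₀ - a)⁻¹ + c / 2) = 0; rw [hq0, mul_zero]
  have hGw₀ : G w₀ ≠ 0 := hG0 w₀ (by rw [sub_self, norm_zero]; exact hr.le)
  have hg1 : deriv g w₀ ≠ 0 := by
    have hqd : HasDerivAt (fun z : ℂ => (z - a)⁻¹ + c / 2) (-1 / (w₀ - a) ^ 2) w₀ := by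
      have h := ((hasDerivAt_id w₀).sub_const a).inv hw₀a'
      simpa using h.add_const (c / 2)
    have hprod := (hG w₀).hasDerivAt.mul hqd
    have hderiv : deriv g w₀ = deriv G w₀ * ((w₀ - a)⁻¹ + c / 2) + G w₀ * (-1 / (w₀ - a) ^ 2) := hprod.deriv
    rw [hderiv, hq0, mul_zero, zero_add]
    exact mul_ne_zero hGw₀ (div_ne_zero (neg_ne_zero.2 one_ne_zero) (pow_ne_zero 2 hw₀a'))
  have huniq : ∀ v ∈ closedBall w₀ r, g v = 0 → v = w₀ := by
    intro v hv hgv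
    have hvball : v ∈ ball w₀ ‖2 / c‖ := by
      rw [mem_ball]; rw [mem_closedBall] at hv; exact lt_of_le_of_lt hv hr2
    have hva : v ≠ a := hne_a v hvball
    have hGv : G v ≠ 0 := hG0 v (by rw [← dist_eq_norm]; exact hv)
    have hq : (v - a)⁻¹ + c / 2 = 0 := by
      rcases mul_eq_zero.1 hgv with h | h
      · exact (hGv h).elim
      · exact h
    rw [inv_add_half_eq hc hva, div_eq_zero_iff] at hq
    rcases hq with h | h
    · rcases mul_eq_zero.1 h with h' | h'
      · exact (hc h').elim
      · rw [hw₀]; exact sub_eq_zero.1 h'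
    · exact (mul_ne_zero two_ne_zero (sub_ne_zero.2 hva) h).elim
  obtain ⟨u, hu, hu0, -, -⟩ :=
    Literature.Analysis.Complex.Rouche.existsUnique_zero_of_norm_sub_lt hr hr2 hfd hgd hR hw₀mem hg0 hg1 huniq
  exact ⟨u, hu, hu0⟩

/-- Geometry of the certificate ball: `‖u − w₀‖ < r`, `‖w₀ − Re a‖ + r ≤ Im a`, `r < Im w₀` ⇒ `u` is an upper point of aʼs closed Jensen disc. -/
theorem nestedStep_of_near {a w₀ u : ℂ} {r : ℝ} (hu : ‖u - w₀‖ < r) (hball : ‖w₀ - (a.re : ℂ)‖ + r ≤ a.im) (hup : r < w₀.im) :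
    NestedStep a u ∧ 0 < u.im := by
  have h1 : ‖u - (a.re : ℂ)‖ ≤ ‖u - w₀‖ + ‖w₀ - (a.re : ℂ)‖ := norm_sub_le_norm_sub_add_norm_sub _ _ _
  have h2 : ‖u - (a.re : ℂ)‖ ≤ |a.im| := by
    calc ‖u - (a.re : ℂ)‖ ≤ ‖u - w₀‖ + ‖w₀ - (a.re : ℂ)‖ := h1
      _ ≤ a.im := by linarith
      _ ≤ |a.im| := le_abs_self _
  have h3 : |(u - w₀).im| ≤ ‖u - w₀‖ := Complex.abs_im_le_norm _
  rw [Complex.sub_im, abs_le] at h3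
  exact ⟨(norm_sub_re_le_iff u a).1 h2, by linarith [h3.1]⟩

/-- The ROUCHÉ CERTIFICATE of a zero `a` of `f^{(j)}` at radius `r` (row-level, explicit): with `c := f^{(j+2)}(a)/f^{(j+1)}(a)` and `w₀ := a − 2/c` —
`0 < r < ‖2/c‖`, the ball `B̄(w₀, r)` lies in aʼs closed disc above the axis, `f^{(j)} ≠ 0` on it, and the regular-part variation of `f^{(j+1)}/f^{(j)}` on its
boundary circle is `< (‖c‖/2)·r`. -/
def RoucheCert (f : ℂ → ℂ) (j : ℕ) (a : ℂ) (r : ℝ) : Prop :=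
  let c := iteratedDeriv (j + 2) f a / iteratedDeriv (j + 1) f a
  0 < r ∧ r < ‖2 / c‖ ∧ ‖(a - 2 / c) - (a.re : ℂ)‖ + r ≤ a.im ∧ r < (a - 2 / c).im ∧
    (∀ z, ‖z - (a - 2 / c)‖ ≤ r → iteratedDeriv j f z ≠ 0) ∧
    ∀ z, ‖z - (a - 2 / c)‖ = r →
      ‖(iteratedDeriv (j + 1) f z / iteratedDeriv j f z - (z - a)⁻¹ - c / 2) * (z - a)‖ < ‖c‖ / 2 * r

/-- ★★ ROUCHÉ CERTIFICATE ⇒ NESTED CHILD: a certified radius produces a non-real zero of `f^{(j+1)}` in aʼs closed Jensen disc, within `r` of the linearised child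
(any differentiable `f`; `c ≠ 0` is part of the data through `r < ‖2/c‖`). -/
theorem exists_nestedChild_of_roucheCert {f : ℂ → ℂ} {j : ℕ} (hf : Differentiable ℂ (iteratedDeriv j f)) {a : ℂ} {r : ℝ}
    (hc : iteratedDeriv (j + 2) f a / iteratedDeriv (j + 1) f a ≠ 0) (hR : RoucheCert f j a r) :
    ∃ u : ℂ, iteratedDeriv (j + 1) f u = 0 ∧ u.im ≠ 0 ∧ NestedStep a u ∧
      ‖u - (a - 2 / (iteratedDeriv (j + 2) f a / iteratedDeriv (j + 1) f a))‖ < r := by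
  obtain ⟨hr, hr2, hball, hup, hG0, hsmall⟩ := hR
  have hsucc : iteratedDeriv (j + 1) f = deriv (iteratedDeriv j f) := iteratedDeriv_succ
  have hsmall' : ∀ z, ‖z - (a - 2 / (iteratedDeriv (j + 2) f a / iteratedDeriv (j + 1) f a))‖ = r →
      ‖(deriv (iteratedDeriv j f) z / iteratedDeriv j f z - (z - a)⁻¹ - iteratedDeriv (j + 2) f a / iteratedDeriv (j + 1) f a / 2) * (z - a)‖ <
        ‖iteratedDeriv (j + 2) f a / iteratedDeriv (j + 1) f a‖ / 2 * r := by
    intro z hz; rw [← hsucc]; exact hsmall z hz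
  obtain ⟨u, hu, hu0⟩ := exists_crit_near_linChild hf hc hr hr2 hG0 hsmall'
  obtain ⟨hN, hupos⟩ := nestedStep_of_near hu hball hup
  exact ⟨u, by rw [hsucc]; exact hu0, hupos.ne', hN, hu⟩

/-- ★ THE ROUCHÉ-CERTIFICATE LAW (OPEN, typed; binders of `TopLinkLawQ`): every simple crossing top admits a certified radius.  PARTIAL by nature (C6: isolation ratio
ρ > .5 on 9/1 163 bank rows) — a price tag; the row-level use is `exists_nestedChild_of_roucheCert`. -/
def RoucheCertLawQ : Prop :=
  ∀ (η : ℝ) (f : ℂ → ℂ) (x₀ s hmax R Hs : ℝ) (B : ℕ), EngineHyps5 2 η f x₀ s hmax R Hs B → ∀ (j : ℕ) (a : ℂ),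
    iteratedDeriv j f a = 0 → 0 < a.im → NoTallerToucher f j a → ¬ JensenIsolated f j a → iteratedDeriv (j + 1) f a ≠ 0 → ∃ r : ℝ, RoucheCert f j a r

/-- ★★ `RoucheCertLawQ ⟹ TopPinningCrossing` (a multiple `a` is its own child; `c ≠ 0` by `deriv2_ne_zero_of_top`). -/
theorem topPinningCrossing_of_roucheCertLaw (hL : RoucheCertLawQ) : TopPinningCrossing := by
  intro η f x₀ s hmax R Hs B hE j a ha hapos hN hJ
  by_cases hda : iteratedDeriv (j + 1) f a = 0
  · exact Or.inl ⟨a, hda, hapos.ne', by show (a.re - a.re) ^ 2 + a.im ^ 2 ≤ a.im ^ 2; simp⟩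
  have hf : RealEntireLt2 f := realEntireLt2_of_hyps hE
  obtain ⟨r, hR⟩ := hL η f x₀ s hmax R Hs B hE j a ha hapos hN hJ hda
  have hc : iteratedDeriv (j + 2) f a / iteratedDeriv (j + 1) f a ≠ 0 :=
    div_ne_zero (deriv2_ne_zero_of_top hf j ha hapos hN hda) hda
  obtain ⟨u, hu, hui, hNu, -⟩ :=
    exists_nestedChild_of_roucheCert (RhW08.WindowLoss.realEntireLt2_iteratedDeriv hf j).diff hc hR
  exact Or.inl ⟨u, hu, hui, hNu⟩

/-- ★★ … hence `RoucheCertLawQ ⟹ TopPinning`. -/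
theorem topPinning_of_roucheCertLaw (hL : RoucheCertLawQ) : TopPinning :=
  topPinning_of_crossing (topPinningCrossing_of_roucheCertLaw hL)

end RhW08.Lens1ArcSign


/-!
# W-08 · 33346 · lens-1 part U — THE ρ-THRESHOLD: an a-priori form of the Rouché child certificate

(lens-1 g8; ONE project import = part S `…R3Lens1ArcSignS`; namespace `RhW08.Lens1ArcSign`; 0 `sorry`; checked BY CHAIN over the tree part M with N, P, Q, S inlined.)
Part Sʼs `RoucheCert` asks for ONE inequality on ONE circle: the regular-part variation `‖(φ_reg(z) − φ_reg(a))·(z − a)‖ < (‖c‖/2)·r` around the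
linearised child `w₀ = a − 2/c` (`c = f^{(j+2)}(a)/f^{(j+1)}(a) = 2φ_reg(a)`).  Here that inequality is DERIVED from a derivative bound — the complex
mean-value inequality on the ball `B̄(a, (1+τ)‖2/c‖)` ⊇ `B̄(w₀, τ‖2/c‖)` — so the certificate becomes a statement about ONE number, the isolation ratio
`S·‖2/c‖²` (C6ʼs `ρ = |φ_reg′(a)|/|φ_reg(a)|² = 4|φ_reg′(a)|/‖c‖²`, taken as a sup over the ball):

* §1 `exists_crit_of_derivBound` (abstract): `G` differentiable, `G′/G = (z − a)⁻¹ + ψ` off `a` on the ball, `ψ(a) = c/2`, `ψ` differentiable with `‖ψ′‖ ≤ S`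
  on `B̄(a, (1+τ)‖2/c‖)`, `G ≠ 0` there off `a`, `0 < τ < 1` and ★ `S·(1+τ)²·‖2/c‖² < τ` ⇒ a zero of `G′` within `τ‖2/c‖` of `w₀` (part S Rouché + Mathlibʼs
  `Convex.norm_image_sub_le_of_norm_deriv_le`).  The threshold `τ/(1+τ)²` is maximal `1/4` at `τ = 1`: in C6ʼs normalisation «`ρ_ball < 1/4`».
* §2 the dictionary for `G = f^{(j)}`: with the cofactor `h` of part Q (`f^{(j)} = pairQ·h`, tree `exists_cofactor`), `pairQ_eq_mul_conj`
  (`pairQ (Re a) (Im a) z = (z − a)(z − ā)`), `logDeriv_eq_inv_add_psi` (`f^{(j+1)}/f^{(j)} = (z − a)⁻¹ + ((z − ā)⁻¹ + h′/h)` off the zeros) and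
  `psi_apply_top` (`(a − ā)⁻¹ + h′/h(a) = c/2`, from Qʼs `linkStart_cofactor`).
* §3 `RhoCert f j a τ S` (row-level: `0 < τ < 1`, `(1+τ)‖2/c‖ < Im a`, the landing of `B̄(w₀, τ‖2/c‖)`, ★ `S(1+τ)²‖2/c‖² < τ`, and the COFACTOR DERIVATIVE
  BOUND `‖((z − ā)⁻¹ + h′/h)′‖ ≤ S`, `h ≠ 0` on `B̄(a, (1+τ)‖2/c‖)` — quantified over every factorisation `f^{(j)} = pairQ·h`, so no ∃ is smuggled) and ★★
  `exists_nestedChild_of_rhoCert` ⇒ a non-real child `u` with `NestedStep a u`; row-level `pinning_of_rhoCert`.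

BANK READING (`linktoy/rhocert.py` on C6ʼs 1 163-row bank, literal `G = e^{gz}∏(z − p)`, `S` = 1.10 × max of `|ψ′|` on a polar grid of the ball,
`τ` scanned in `.05 … .95`; 5 cpu-s): ★ `RhoCert` certifies 801/1 163 rows (every one of them also Rouché-certified by part S, which has 946; first
certifying `τ`: .05 ×342, .10 ×194, .15 ×105, .20 ×70, ≥ .25 ×90).  By C6ʼs point ratio `ρ(a) = 4|ψ′(a)|/‖c‖²`: `ρ < .05`: 555/561 · `[.05,.10)`: 213/303 ·
`[.10,.15)`: 33/158 · `ρ ≥ .15`: 0/141 (Rouché: 561 · 283 · 95 · 7) — the a-priori form owns the ISOLATED regime and stops where `ρ_ball` (a sup over the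
ball, larger than `ρ(a)`) crosses `τ/(1+τ)² ≤ 1/4`.  The complement (twins / both-sided clusters: lower zeros cancel in `c` but add in `S`) is where the
near child is not near; there parts T (capture-safe point certificate, 1 163/1 163 on the bank) and the Newton–Rouché certificate do the work.
No law is defined here.  NOT claimed: `RoucheCertLawQ`, `TopLinkLawQ`, `TopPinning`.  Nothing here bears on the truth of RH; RH is not proved.
-/

noncomputable section

namespace RhW08.Lens1ArcSign

open Complex Set Metric Filter Topology
open scoped Real ComplexConjugate
open Literature.Topology.PlaneTopology Literature.Analysis.Complex
open Summit.RiemannHypothesis.RiemannHypothesis.Theorems.Splittings.JensenWindow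
open RhIdea6.G17.W07C7 RhIdea6.G17.W07C7.Rev6 RhIdea6.G18.W07C8.Law421BirthS RhIdea6.G19.W07C11.Seam
open RhIdea6.G20.W07C12.Frac RhIdea6.G20.W07C12.StColP RhW07.C12.FieldSplit RhIdea6.G21.W07C13.TentMax
open RhW07.C14.TwoSided RhW07.C14.Classes RhW07.C14.Lineage RhW07.C14.Booking
open RhW07.C13.Heredity RhIdea6.G22.W07C15pre.Injection RhW07.E3.Cell RhW07.E3.Lit
open RhW08.Round1 RhW08.StSwap RhW08.Round2 RhW08.QuadW RhW08.SealSwapQ RhW08.SealSwap RhW08.SuccB RhW08.SuccSplit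
open RhW08.SuccTheft RhW08.Column RhW08.Hurwitz RhW08.ClusterQ RhW08.ClusterQM RhW08.NewtonDoor RhW08.NewtonDoorGenusOne RhW08.PurseP
open RhW08.Lens1SignCut RhW08.Lens1Coverage RhW08.IsolatedTilt RhW08.Lens1Pinning RhW08.Lens1PinningIso

/-! ## §1 the abstract ρ-threshold -/

/-- ★ ρ-THRESHOLD (abstract): a derivative bound for the regular part `ψ` of `G′/G` at `a` on `B̄(a, (1+τ)‖2/c‖)` with `S(1+τ)²‖2/c‖² < τ` gives part Sʼs
Rouché smallness, hence a critical point of `G` within `τ‖2/c‖` of `w₀ = a − 2/c`. -/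
theorem exists_crit_of_derivBound {G ψ : ℂ → ℂ} (hG : Differentiable ℂ G) {a c : ℂ} (hc : c ≠ 0) {τ S : ℝ} (hτ : 0 < τ) (hτ1 : τ < 1)
    (hψd : ∀ z ∈ closedBall a ((1 + τ) * ‖2 / c‖), DifferentiableAt ℂ ψ z)
    (hψb : ∀ z ∈ closedBall a ((1 + τ) * ‖2 / c‖), ‖deriv ψ z‖ ≤ S)
    (hG0 : ∀ z ∈ closedBall a ((1 + τ) * ‖2 / c‖), z ≠ a → G z ≠ 0)
    (hlog : ∀ z ∈ closedBall a ((1 + τ) * ‖2 / c‖), z ≠ a → deriv G z / G z = (z - a)⁻¹ + ψ z)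
    (hψa : ψ a = c / 2) (hρ : S * (1 + τ) ^ 2 * ‖2 / c‖ ^ 2 < τ) :
    ∃ u : ℂ, ‖u - (a - 2 / c)‖ < τ * ‖2 / c‖ ∧ deriv G u = 0 := by
  have h2c : 0 < ‖2 / c‖ := norm_pos_iff.2 (div_ne_zero two_ne_zero hc)
  have hr : 0 < τ * ‖2 / c‖ := mul_pos hτ h2c
  have hr2 : τ * ‖2 / c‖ < ‖2 / c‖ := by nlinarith
  have haw : a - (a - 2 / c) = 2 / c := by ring
  -- the closed Rouché ball sits inside the big closed ball and misses `a`
  have hsub : ∀ z, ‖z - (a - 2 / c)‖ ≤ τ * ‖2 / c‖ → z ∈ closedBall a ((1 + τ) * ‖2 / c‖) ∧ z ≠ a := by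
    intro z hz
    refine ⟨?_, ?_⟩
    · rw [mem_closedBall, dist_eq_norm]
      calc ‖z - a‖ = ‖(z - (a - 2 / c)) - 2 / c‖ := by ring_nf
        _ ≤ ‖z - (a - 2 / c)‖ + ‖2 / c‖ := norm_sub_le _ _
        _ ≤ (1 + τ) * ‖2 / c‖ := by linarith
    · rintro rfl
      rw [haw] at hz
      linarith
  have ha_mem : a ∈ closedBall a ((1 + τ) * ‖2 / c‖) := mem_closedBall_self (by positivity)
  have hS0 : 0 ≤ S := le_trans (norm_nonneg _) (hψb a ha_mem)
  have hcnorm : ‖c‖ / 2 * (τ * ‖2 / c‖) = τ := by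
    rw [norm_div, Complex.norm_two]
    field_simp
  refine exists_crit_near_linChild hG hc hr hr2 (fun z hz => (hG0 z (hsub z hz).1 (hsub z hz).2)) ?_
  intro z hz
  obtain ⟨hzmem, hza⟩ := hsub z hz.le
  have hmvt : ‖ψ z - ψ a‖ ≤ S * ‖z - a‖ :=
    (convex_closedBall a ((1 + τ) * ‖2 / c‖)).norm_image_sub_le_of_norm_deriv_le hψd hψb ha_mem hzmem
  have hza_le : ‖z - a‖ ≤ (1 + τ) * ‖2 / c‖ := by rw [← dist_eq_norm]; exact hzmem
  rw [hlog z hzmem hza, ← hψa, show ((z - a)⁻¹ + ψ z - (z - a)⁻¹ - ψ a) * (z - a) = (ψ z - ψ a) * (z - a) by ring, norm_mul, hcnorm]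
  calc ‖ψ z - ψ a‖ * ‖z - a‖ ≤ S * ‖z - a‖ * ‖z - a‖ := mul_le_mul_of_nonneg_right hmvt (norm_nonneg _)
    _ ≤ S * ((1 + τ) * ‖2 / c‖) * ((1 + τ) * ‖2 / c‖) := by
        have h1 : S * ‖z - a‖ ≤ S * ((1 + τ) * ‖2 / c‖) := mul_le_mul_of_nonneg_left hza_le hS0
        exact mul_le_mul h1 hza_le (norm_nonneg _) (by positivity)
    _ = S * (1 + τ) ^ 2 * ‖2 / c‖ ^ 2 := by ring
    _ < τ := hρ

/-! ## §2 the dictionary for `G = f^{(j)}`: pair factor, logarithmic derivative, value at the top -/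

/-- `pairQ (Re a) (Im a) z = (z − a)(z − ā)`. -/
theorem pairQ_eq_mul_conj (a z : ℂ) : pairQ a.re a.im z = (z - a) * (z - conj a) := by
  apply Complex.ext
  · rw [RhW08.FarStep.pairQ_re]
    simp only [Complex.mul_re, Complex.sub_re, Complex.sub_im, Complex.conj_re, Complex.conj_im]
    ring
  · rw [RhW08.FarStep.pairQ_im]
    simp only [Complex.mul_im, Complex.sub_re, Complex.sub_im, Complex.conj_re, Complex.conj_im]
    ring

/-- Off the zeros, `(pairQ·h)′/(pairQ·h) = (z − a)⁻¹ + ((z − ā)⁻¹ + h′/h)`. -/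
theorem logDeriv_eq_inv_add_psi {G h : ℂ → ℂ} (hh : Differentiable ℂ h) {a : ℂ} (hfac : ∀ z, G z = pairQ a.re a.im z * h z) {z : ℂ}
    (hza : z ≠ a) (hzb : z ≠ conj a) (hhz : h z ≠ 0) :
    deriv G z / G z = (z - a)⁻¹ + ((z - conj a)⁻¹ + deriv h z / h z) := by
  have eG : G = pairQ a.re a.im * h := funext fun u => by rw [Pi.mul_apply]; exact hfac u
  have hq : HasDerivAt (pairQ a.re a.im) (2 * (z - a.re)) z := RhW07.Law421.SuccessorCertificate.hasDerivAt_quadP a.re a.im z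
  have hd : deriv G z = 2 * (z - a.re) * h z + pairQ a.re a.im z * deriv h z := by rw [eG, (hq.mul (hh z).hasDerivAt).deriv]
  have hza' : z - a ≠ 0 := sub_ne_zero.2 hza
  have hzb' : z - conj a ≠ 0 := sub_ne_zero.2 hzb
  have h2 : (2 : ℂ) * (z - a.re) = (z - a) + (z - conj a) := by
    apply Complex.ext
    · simp; ring
    · simp; ring
  rw [hd, hfac z, pairQ_eq_mul_conj, h2]
  field_simp
  ring

/-- At the top: `(a − ā)⁻¹ + h′/h(a) = c/2` with `c = f^{(j+2)}(a)/f^{(j+1)}(a)` (from Qʼs `linkStart_cofactor` ratio `c = (a − Re a)⁻¹ + 2h′/h(a)`). -/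
theorem psi_apply_top {a K c : ℂ} (ha : a.im ≠ 0) (hratio : c = (a - (a.re : ℂ))⁻¹ + (K + K)) : (a - conj a)⁻¹ + K = c / 2 := by
  have e1 : a - conj a = 2 * (a - (a.re : ℂ)) := by
    apply Complex.ext
    · simp
    · simp; ring
  have hne : a - (a.re : ℂ) ≠ 0 := by
    intro h0
    have := congrArg Complex.im h0
    simp at this
    exact ha this
  rw [hratio, e1, mul_inv]
  field_simp
  ring

/-! ## §3 the ρ-certificate of a top and its producer -/

/-- The ρ-CERTIFICATE of a zero `a` of `f^{(j)}` (row-level, explicit; `c := f^{(j+2)}(a)/f^{(j+1)}(a)`, `w₀ := a − 2/c`, `R₁ := (1+τ)‖2/c‖`): `0 < τ < 1`,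
`R₁ < Im a`, the Rouché ball `B̄(w₀, τ‖2/c‖)` lands in aʼs closed disc above the axis, ★ `S(1+τ)²‖2/c‖² < τ`, and for EVERY differentiable cofactor `h`
with `f^{(j)} = pairQ (Re a) (Im a)·h`: `h ≠ 0` and `‖((z − ā)⁻¹ + h′/h)′(z)‖ ≤ S` on `B̄(a, R₁)`. -/
def RhoCert (f : ℂ → ℂ) (j : ℕ) (a : ℂ) (τ S : ℝ) : Prop :=
  let c := iteratedDeriv (j + 2) f a / iteratedDeriv (j + 1) f a
  0 < τ ∧ τ < 1 ∧ (1 + τ) * ‖2 / c‖ < a.im ∧ ‖(a - 2 / c) - (a.re : ℂ)‖ + τ * ‖2 / c‖ ≤ a.im ∧ τ * ‖2 / c‖ < (a - 2 / c).im ∧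
    S * (1 + τ) ^ 2 * ‖2 / c‖ ^ 2 < τ ∧
    ∀ h : ℂ → ℂ, Differentiable ℂ h → (∀ z, iteratedDeriv j f z = pairQ a.re a.im z * h z) →
      ∀ z ∈ closedBall a ((1 + τ) * ‖2 / c‖), h z ≠ 0 ∧ ‖deriv (fun u => (u - conj a)⁻¹ + deriv h u / h u) z‖ ≤ S

/-- ★★ ρ-CERTIFICATE ⇒ NESTED CHILD: `f` real entire of order `< 2`, `a` a SIMPLE upper zero of `f^{(j)}` with `NoTallerToucher`, and `RhoCert f j a τ S` ⇒ a
non-real zero `u` of `f^{(j+1)}` with `NestedStep a u` (within `τ‖2/c‖` of the linearised child). -/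
theorem exists_nestedChild_of_rhoCert {f : ℂ → ℂ} (hf : RealEntireLt2 f) (j : ℕ) {a : ℂ} (ha : iteratedDeriv j f a = 0) (hapos : 0 < a.im)
    (hN : NoTallerToucher f j a) (hsimp : iteratedDeriv (j + 1) f a ≠ 0) {τ S : ℝ} (hR : RhoCert f j a τ S) :
    ∃ u : ℂ, iteratedDeriv (j + 1) f u = 0 ∧ u.im ≠ 0 ∧ NestedStep a u ∧
      ‖u - (a - 2 / (iteratedDeriv (j + 2) f a / iteratedDeriv (j + 1) f a))‖ < τ * ‖2 / (iteratedDeriv (j + 2) f a / iteratedDeriv (j + 1) f a)‖ := by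
  obtain ⟨hτ, hτ1, hR1, hball, hup, hρ, hcof⟩ := hR
  set c : ℂ := iteratedDeriv (j + 2) f a / iteratedDeriv (j + 1) f a with hcdef
  obtain ⟨h, hhd, -, -, hha, hfac, -, hratio⟩ := linkStart_cofactor hf j ha hapos hN hsimp
  have hc : c ≠ 0 := by rw [hcdef]; exact div_ne_zero (deriv2_ne_zero_of_top hf j ha hapos hN hsimp) hsimp
  have hG : Differentiable ℂ (iteratedDeriv j f) := (RhW08.WindowLoss.realEntireLt2_iteratedDeriv hf j).diff
  have hcof' := hcof h hhd hfac
  -- points of the big closed ball are neither `a`… (only off `a` below) nor `ā`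
  have hnb : ∀ z ∈ closedBall a ((1 + τ) * ‖2 / c‖), z ≠ conj a := by
    intro z hz hzb
    rw [mem_closedBall, dist_eq_norm, hzb] at hz
    have e : ‖conj a - a‖ = 2 * a.im := by
      have e1 : conj a - a = -(2 * (a.im : ℂ) * I) := by
        apply Complex.ext
        · simp
        · simp; ring
      rw [e1, norm_neg, norm_mul, norm_mul, Complex.norm_two, Complex.norm_real, Complex.norm_I, mul_one, Real.norm_eq_abs,
        abs_of_pos hapos]
    rw [e] at hz
    linarith
  set ψ : ℂ → ℂ := fun u => (u - conj a)⁻¹ + deriv h u / h u with hψdef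
  have hψd : ∀ z ∈ closedBall a ((1 + τ) * ‖2 / c‖), DifferentiableAt ℂ ψ z := by
    intro z hz
    have h1 : DifferentiableAt ℂ (fun u : ℂ => (u - conj a)⁻¹) z :=
      (differentiableAt_id.sub_const (conj a)).inv (sub_ne_zero.2 (hnb z hz))
    have h2 : DifferentiableAt ℂ (fun u : ℂ => deriv h u / h u) z :=
      ((differentiable_deriv hhd) z).div (hhd z) (hcof' z hz).1
    exact h1.add h2
  have hψb : ∀ z ∈ closedBall a ((1 + τ) * ‖2 / c‖), ‖deriv ψ z‖ ≤ S := fun z hz => (hcof' z hz).2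
  have hG0 : ∀ z ∈ closedBall a ((1 + τ) * ‖2 / c‖), z ≠ a → iteratedDeriv j f z ≠ 0 := by
    intro z hz hza
    rw [hfac z]
    exact mul_ne_zero (pairQ_ne_zero_of_ne hza (hnb z hz)) (hcof' z hz).1
  have hlog : ∀ z ∈ closedBall a ((1 + τ) * ‖2 / c‖), z ≠ a →
      deriv (iteratedDeriv j f) z / iteratedDeriv j f z = (z - a)⁻¹ + ψ z :=
    fun z hz hza => logDeriv_eq_inv_add_psi hhd hfac hza (hnb z hz) (hcof' z hz).1
  have hψa : ψ a = c / 2 := psi_apply_top hapos.ne' (by rw [hcdef]; exact hratio)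
  obtain ⟨u, hu, hu0⟩ := exists_crit_of_derivBound hG hc hτ hτ1 hψd hψb hG0 hlog hψa hρ
  have hs1 : iteratedDeriv (j + 1) f = deriv (iteratedDeriv j f) := iteratedDeriv_succ
  obtain ⟨hn, hupos⟩ := nestedStep_of_near hu hball hup
  exact ⟨u, by rw [hs1]; exact hu0, hupos.ne', hn, hu⟩

/-- Row-level producer: a ρ-certificate at a zero `a` of `f^{(j)}` on a legal frame gives `TopPinning`ʼs first disjunct for `a` (a multiple `a` is its own child). -/
theorem pinning_of_rhoCert {η : ℝ} {f : ℂ → ℂ} {x₀ s hmax R Hs : ℝ} {B : ℕ} (hE : EngineHyps5 2 η f x₀ s hmax R Hs B) {j : ℕ} {a : ℂ}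
    (ha : iteratedDeriv j f a = 0) (hapos : 0 < a.im) (hN : NoTallerToucher f j a) {τ S : ℝ} (hR : RhoCert f j a τ S) :
    (∃ u : ℂ, iteratedDeriv (j + 1) f u = 0 ∧ u.im ≠ 0 ∧ NestedStep a u) ∨ (∃ x : ℝ, |x - a.re| ≤ a.im ∧ NLEventOf f j x) := by
  by_cases hda : iteratedDeriv (j + 1) f a = 0
  · exact Or.inl ⟨a, hda, hapos.ne', by show (a.re - a.re) ^ 2 + a.im ^ 2 ≤ a.im ^ 2; simp⟩
  obtain ⟨u, hu, hui, hn, -⟩ := exists_nestedChild_of_rhoCert (realEntireLt2_of_hyps hE) j ha hapos hN hda hR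
  exact Or.inl ⟨u, hu, hui, hn⟩

end RhW08.Lens1ArcSign


/-!
# W-08 · 33346 · lens-1 part V — CLUSTER CERTIFICATES: Rouché against the linearised cluster, and the twin (k = 2) producer

(lens-1 g8; ONE project import = part U `…R3Lens1ArcSignU`; namespace `RhW08.Lens1ArcSign`; 0 `sorry`; checked BY CHAIN over the tree part M with N, P, Q, S, U inlined.)
Parts S/U linearise `f^{(j+1)}/f^{(j)}` at the top `a` keeping ONE pole: `(z − a)⁻¹ + ψ`.  That is the right expansion exactly when no other zero
sits within `O(‖2/c‖)` of `a` (the isolated regime, U: 801/1 163 bank rows a priori).  In a CLUSTER (twins, triples) one keeps the `k` nearest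
poles exactly — `f^{(j+1)}/f^{(j)} = Σ_{q ∈ Q} (z − q)⁻¹ + ψ_k` — and runs Rouché against the linearised cluster numerator
`N(z) = Π(z)·(Σ_q (z − q)⁻¹ + ψ_k(a))`, a polynomial of degree `k`, around one of its roots `w₀` (a CLUSTER CHILD):

* §1 ★ `exists_crit_of_clusterCert` (abstract, k-free): `G`, `Π` differentiable, `G ≠ 0` on `B̄(w₀, r)`, `Π ≠ 0` on `B(w₀, r)`, `d ≠ 0`, and ONE circle
  inequality `‖(G′/G)(z)·Π(z) − d·(z − w₀)‖ < ‖d‖·r` on `‖z − w₀‖ = r` ⇒ a zero of `G′` in `B(w₀, r)` (Literature Rouché `existsUnique_zero_of_norm_sub_lt`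
  with `f := G′·Π` against `g := d(z − w₀)·G`).  Neither `N` nor the exactness of the root `w₀` enters: `w₀`, `d` are free row data (an approximate
  root and `d ≈ N′(w₀)` are what an instrument supplies).  `k = 1`, `M = z − a`, `d = c/2` is part Sʼs `exists_crit_near_linChild` (an unnamed `example` checks it).
* §2 the twin dictionary: with the cofactors `f^{(j)} = pairQ_a·h` (Q) and `h = pairQ_b·h₂` (tree `exists_cofactor` again, at the second zero `b`):
  `f^{(j+1)}/f^{(j)} = (z − a)⁻¹ + (z − b)⁻¹ + ψ₂`, `ψ₂ = (z − ā)⁻¹ + (z − b̄)⁻¹ + h₂′/h₂`, and `ψ₂(a) = c/2 − (a − b)⁻¹` (`psi2_apply_top`).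
* §3 `TwinCert f j a b w₀ d r S` (row-level, explicit: `b` another upper zero of `f^{(j)}`, the Rouché ball `B̄(w₀, r)` free of zeros of `f^{(j)}`,
  landing in `a`ʼs closed disc with `‖w₀ − a‖ + r < Im a`, the cofactor derivative bound `‖ψ₂′‖ ≤ S`, `h₂ ≠ 0` on `B̄(a, ‖w₀ − a‖ + r)` — quantified over
  every factorisation — and ★ the circle inequality `‖N(z) − d(z − w₀)‖ + S‖z − a‖‖(z − a)(z − b)‖ < ‖d‖ r`, `N(z) = (z − a) + (z − b) + C(z − a)(z − b)`,
  `C = c/2 − (a − b)⁻¹`) and ★★ `exists_nestedChild_of_twinCert` ⇒ a non-real child `u` with `NestedStep a u`, `‖u − w₀‖ < r`; `pinning_of_twinCert`.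

BANK READING (`linktoy/clustercert.py`, C6ʼs 1 163 rows, literal `G = e^{gz}∏(z − p)`, `Q` = `a` + the `k − 1` nearest poles, `w₀` = a root of `N`
by Durand–Kerner, `S` = 1.10 × grid max of `|ψ_k′|`, 10 cpu-s): minimal certifying `k`: ★ `k = 1`: 803 · `k = 2`: 343 · `k = 3`: 10 · `k = 4`: 5 ⇒
1 161/1 163 rows carry an A-PRIORI cluster certificate (open at `k ≤ 4`: rows 75, 932); the twin certificate alone (`linktoy/twincert.py`, nearest
pole = an upper zero in 1 100 rows, a real zero in 63): 1 138/1 163.  So on the bank the ∀-law `TopPinning` factors as: (i) a cluster of `≤ 4` poles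
isolates (regular remainder has small derivative on the interaction ball), (ii) the linearised cluster has a child landing in `D̄_a`.  (ii) for `k = 1`
is `LinkStartLawQ` (PROVED, Q); for `k ≥ 2` it is the open analogue («cluster start law»).  No law is defined here.
NOT claimed: any ∀-law, `TopPinning`.  Nothing here bears on the truth of RH; RH is not proved.
-/

noncomputable section

namespace RhW08.Lens1ArcSign

open Complex Set Metric Filter Topology
open scoped Real ComplexConjugate
open Literature.Topology.PlaneTopology Literature.Analysis.Complex
open Summit.RiemannHypothesis.RiemannHypothesis.Theorems.Splittings.JensenWindow
open RhIdea6.G17.W07C7 RhIdea6.G17.W07C7.Rev6 RhIdea6.G18.W07C8.Law421BirthS RhIdea6.G19.W07C11.Seam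
open RhIdea6.G20.W07C12.Frac RhIdea6.G20.W07C12.StColP RhW07.C12.FieldSplit RhIdea6.G21.W07C13.TentMax
open RhW07.C14.TwoSided RhW07.C14.Classes RhW07.C14.Lineage RhW07.C14.Booking
open RhW07.C13.Heredity RhIdea6.G22.W07C15pre.Injection RhW07.E3.Cell RhW07.E3.Lit
open RhW08.Round1 RhW08.StSwap RhW08.Round2 RhW08.QuadW RhW08.SealSwapQ RhW08.SealSwap RhW08.SuccB RhW08.SuccSplit
open RhW08.SuccTheft RhW08.Column RhW08.Hurwitz RhW08.ClusterQ RhW08.ClusterQM RhW08.NewtonDoor RhW08.NewtonDoorGenusOne RhW08.PurseP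
open RhW08.Lens1SignCut RhW08.Lens1Coverage RhW08.IsolatedTilt RhW08.Lens1Pinning RhW08.Lens1PinningIso

/-! ## §1 Rouché against a linearised cluster (abstract, k-free) -/

/-- ★ CLUSTER ROUCHÉ: `G`, `M` differentiable (`M` = the cluster polynomial `Π_q (z − q)` in use), `G ≠ 0` on the closed ball `B̄(w₀, r)`, `M ≠ 0` on the
open ball, `d ≠ 0`, and `‖(G′/G)(z)·M(z) − d(z − w₀)‖ < ‖d‖ r` on the circle ⇒ `G′` has a zero in `B(w₀, r)`. -/
theorem exists_crit_of_clusterCert {G M : ℂ → ℂ} (hG : Differentiable ℂ G) (hM : Differentiable ℂ M) {w₀ d : ℂ} (hd : d ≠ 0) {r : ℝ}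
    (hr : 0 < r) (hG0 : ∀ z, ‖z - w₀‖ ≤ r → G z ≠ 0) (hM0 : ∀ z, ‖z - w₀‖ < r → M z ≠ 0)
    (hsmall : ∀ z, ‖z - w₀‖ = r → ‖deriv G z / G z * M z - d * (z - w₀)‖ < ‖d‖ * r) :
    ∃ u : ℂ, ‖u - w₀‖ < r ∧ deriv G u = 0 := by
  set g : ℂ → ℂ := fun z => d * (z - w₀) * G z with hg
  have hlin : Differentiable ℂ (fun z : ℂ => d * (z - w₀)) := (differentiable_id.sub_const w₀).const_mul d
  have hgd : DifferentiableOn ℂ g (ball w₀ (r + 1)) := (hlin.mul hG).differentiableOn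
  have hfd : DifferentiableOn ℂ (fun z => deriv G z * M z) (ball w₀ (r + 1)) := ((differentiable_deriv hG).mul hM).differentiableOn
  have hR : ∀ z : ℂ, ‖z - w₀‖ = r → ‖deriv G z * M z - g z‖ < ‖g z‖ := by
    intro z hz
    have hGz : G z ≠ 0 := hG0 z hz.le
    have hgz : g z = d * (z - w₀) * G z := rfl
    have h1 : deriv G z * M z - g z = G z * (deriv G z / G z * M z - d * (z - w₀)) := by rw [hgz]; field_simp
    rw [h1, norm_mul, hgz, norm_mul, norm_mul, hz, mul_comm ‖G z‖]
    exact mul_lt_mul_of_pos_right (hsmall z hz) (norm_pos_iff.2 hGz)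
  have hw₀mem : w₀ ∈ closedBall w₀ r := mem_closedBall_self hr.le
  have hg0 : g w₀ = 0 := by show d * (w₀ - w₀) * G w₀ = 0; simp
  have hGw₀ : G w₀ ≠ 0 := hG0 w₀ (by rw [sub_self, norm_zero]; exact hr.le)
  have hg1 : deriv g w₀ ≠ 0 := by
    have hl : HasDerivAt (fun z : ℂ => d * (z - w₀)) d w₀ := by
      simpa using ((hasDerivAt_id w₀).sub_const w₀).const_mul d
    have hprod := hl.mul (hG w₀).hasDerivAt
    have hderiv : deriv g w₀ = d * G w₀ + d * (w₀ - w₀) * deriv G w₀ := hprod.deriv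
    rw [hderiv, sub_self, mul_zero, zero_mul, add_zero]
    exact mul_ne_zero hd hGw₀
  have huniq : ∀ v ∈ closedBall w₀ r, g v = 0 → v = w₀ := by
    intro v hv hgv
    have hGv : G v ≠ 0 := hG0 v (by rw [← dist_eq_norm]; exact hv)
    rcases mul_eq_zero.1 hgv with h | h
    · rcases mul_eq_zero.1 h with h' | h'
      · exact (hd h').elim
      · exact sub_eq_zero.1 h'
    · exact (hGv h).elim
  obtain ⟨u, hu, hu0, -, -⟩ :=
    Literature.Analysis.Complex.Rouche.existsUnique_zero_of_norm_sub_lt hr (by linarith) hfd hgd hR hw₀mem hg0 hg1 huniq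
  have hMu : M u ≠ 0 := hM0 u hu
  rcases mul_eq_zero.1 hu0 with h | h
  · exact ⟨u, hu, h⟩
  · exact (hMu h).elim

/-! ## §2 the twin dictionary -/

/-- At the top of a twin: `(a − ā)⁻¹ + (a − b̄)⁻¹ + h₂′/h₂(a) = c/2 − (a − b)⁻¹`, from `c = (a − Re a)⁻¹ + 2h′/h(a)` (Q) and
`h′/h(a) = (a − b)⁻¹ + ((a − b̄)⁻¹ + h₂′/h₂(a))` (part U at the zero `b` of `h`). -/
theorem psi2_apply_top {a b K K₂ c : ℂ} (ha : a.im ≠ 0) (hratio : c = (a - (a.re : ℂ))⁻¹ + (K + K))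
    (hK : K = (a - b)⁻¹ + ((a - conj b)⁻¹ + K₂)) : (a - conj a)⁻¹ + (a - conj b)⁻¹ + K₂ = c / 2 - (a - b)⁻¹ := by
  have h1 : (a - conj a)⁻¹ + K = c / 2 := psi_apply_top ha hratio
  rw [hK] at h1
  linear_combination h1

/-- `pairQ (Re v) (Im v) z ≠ 0` splits as `z ≠ v ∧ z ≠ v̄`. -/
theorem ne_and_ne_conj_of_pairQ_ne_zero {v z : ℂ} (h : pairQ v.re v.im z ≠ 0) : z ≠ v ∧ z ≠ conj v := by
  rw [pairQ_eq_mul_conj] at h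
  exact ⟨fun e => h (by rw [e, sub_self, zero_mul]), fun e => h (by rw [e, sub_self, mul_zero])⟩

/-- The algebra of the twin comparison: `(Σ poles + ψ)·Π − d(z − w₀) = (N − d(z − w₀)) + (ψ − ψ(a))·Π`. -/
theorem twin_compare_eq {z a b w₀ d P : ℂ} (Pa : ℂ) (hza : z ≠ a) (hzb : z ≠ b) :
    ((z - a)⁻¹ + (z - b)⁻¹ + P) * ((z - a) * (z - b)) - d * (z - w₀) =
      (((z - a) + (z - b) + Pa * (z - a) * (z - b)) - d * (z - w₀)) + (P - Pa) * ((z - a) * (z - b)) := by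
  have hza' : z - a ≠ 0 := sub_ne_zero.2 hza
  have hzb' : z - b ≠ 0 := sub_ne_zero.2 hzb
  field_simp
  ring

/-! ## §3 the twin certificate and its producer -/

/-- The TWIN CERTIFICATE of a top `a` with a companion zero `b` (row-level, explicit; `c := f^{(j+2)}(a)/f^{(j+1)}(a)`, `C := c/2 − (a − b)⁻¹`,
`N(z) := (z − a) + (z − b) + C(z − a)(z − b)`; `w₀`, `d`, `r`, `S` free row data — an approximate cluster child, `≈ N′(w₀)`, a radius, a bound). -/
def TwinCert (f : ℂ → ℂ) (j : ℕ) (a b w₀ d : ℂ) (r S : ℝ) : Prop :=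
  let c := iteratedDeriv (j + 2) f a / iteratedDeriv (j + 1) f a
  iteratedDeriv j f b = 0 ∧ 0 < b.im ∧ b ≠ a ∧ 0 < r ∧ d ≠ 0 ∧ ‖w₀ - a‖ + r < a.im ∧ ‖w₀ - (a.re : ℂ)‖ + r ≤ a.im ∧ r < w₀.im ∧
    (∀ z, ‖z - w₀‖ ≤ r → iteratedDeriv j f z ≠ 0) ∧
    (∀ h₂ : ℂ → ℂ, Differentiable ℂ h₂ → (∀ z, iteratedDeriv j f z = pairQ a.re a.im z * (pairQ b.re b.im z * h₂ z)) →
      ∀ z ∈ closedBall a (‖w₀ - a‖ + r), h₂ z ≠ 0 ∧ ‖deriv (fun u => (u - conj a)⁻¹ + (u - conj b)⁻¹ + deriv h₂ u / h₂ u) z‖ ≤ S) ∧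
    ∀ z, ‖z - w₀‖ = r →
      ‖((z - a) + (z - b) + (c / 2 - (a - b)⁻¹) * (z - a) * (z - b)) - d * (z - w₀)‖ + S * ‖z - a‖ * ‖(z - a) * (z - b)‖ < ‖d‖ * r

/-- ★★ TWIN CERTIFICATE ⇒ NESTED CHILD: `f` real entire of order `< 2`, `a` a SIMPLE upper zero of `f^{(j)}` with `NoTallerToucher`, and
`TwinCert f j a b w₀ d r S` ⇒ a non-real zero `u` of `f^{(j+1)}` with `NestedStep a u`, within `r` of the cluster child `w₀`. -/
theorem exists_nestedChild_of_twinCert {f : ℂ → ℂ} (hf : RealEntireLt2 f) (j : ℕ) {a : ℂ} (ha : iteratedDeriv j f a = 0) (hapos : 0 < a.im)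
    (hN : NoTallerToucher f j a) (hsimp : iteratedDeriv (j + 1) f a ≠ 0) {b w₀ d : ℂ} {r S : ℝ} (hT : TwinCert f j a b w₀ d r S) :
    ∃ u : ℂ, iteratedDeriv (j + 1) f u = 0 ∧ u.im ≠ 0 ∧ NestedStep a u ∧ ‖u - w₀‖ < r := by
  obtain ⟨hb, hbpos, hba, hr, hd, hK, hball, hup, hG0, hcof, hsmall⟩ := hT
  set c : ℂ := iteratedDeriv (j + 2) f a / iteratedDeriv (j + 1) f a with hcdef
  obtain ⟨h, hhd, hgrow, hreal, -, hfac, -, hratio⟩ := linkStart_cofactor hf j ha hapos hN hsimp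
  have hGd : Differentiable ℂ (iteratedDeriv j f) := (RhW08.WindowLoss.realEntireLt2_iteratedDeriv hf j).diff
  have hbc : b ≠ conj a := by
    intro e
    have := congrArg Complex.im e
    simp at this
    linarith
  have hhb : h b = 0 := by
    have e := hfac b
    rw [hb] at e
    rcases mul_eq_zero.1 e.symm with h0 | h0
    · exact ((pairQ_ne_zero_of_ne hba hbc) h0).elim
    · exact h0
  obtain ⟨h₂, hh₂d, -, -, hfacb⟩ := RhW08.NestedSign.exists_cofactor (G := h) ⟨hhd, hgrow, hreal⟩ hhb hbpos.ne'
  have hfac₂ : ∀ z, iteratedDeriv j f z = pairQ a.re a.im z * (pairQ b.re b.im z * h₂ z) := fun z => by rw [hfac z, hfacb z]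
  have hcof' := hcof h₂ hh₂d hfac₂
  -- the MVT ball `K = B̄(a, ‖w₀ − a‖ + r)` contains the Rouché ball and `a`, and avoids `ā`, `b̄`
  have hmemK : ∀ z, ‖z - w₀‖ ≤ r → z ∈ closedBall a (‖w₀ - a‖ + r) := by
    intro z hz
    rw [mem_closedBall, dist_eq_norm]
    calc ‖z - a‖ = ‖(z - w₀) + (w₀ - a)‖ := by ring_nf
      _ ≤ ‖z - w₀‖ + ‖w₀ - a‖ := norm_add_le _ _
      _ ≤ ‖w₀ - a‖ + r := by linarith
  have ha_mem : a ∈ closedBall a (‖w₀ - a‖ + r) := mem_closedBall_self (by positivity)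
  have hKa : ∀ z ∈ closedBall a (‖w₀ - a‖ + r), z ≠ conj a := by
    intro z hz e
    rw [mem_closedBall, dist_eq_norm, e] at hz
    have h0 : |(conj a - a).im| ≤ ‖conj a - a‖ := Complex.abs_im_le_norm _
    have h1 : (conj a - a).im = -(a.im + a.im) := by simp; ring
    rw [h1, abs_neg, abs_of_pos (by positivity)] at h0
    linarith
  have hKb : ∀ z ∈ closedBall a (‖w₀ - a‖ + r), z ≠ conj b := by
    intro z hz e
    rw [mem_closedBall, dist_eq_norm, e] at hz
    have h0 : |(conj b - a).im| ≤ ‖conj b - a‖ := Complex.abs_im_le_norm _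
    have h1 : (conj b - a).im = -(a.im + b.im) := by simp; ring
    rw [h1, abs_neg, abs_of_pos (by positivity)] at h0
    linarith
  -- the regular part `ψ₂`
  set ψ₂ : ℂ → ℂ := fun u => (u - conj a)⁻¹ + (u - conj b)⁻¹ + deriv h₂ u / h₂ u with hψdef
  have hψd : ∀ z ∈ closedBall a (‖w₀ - a‖ + r), DifferentiableAt ℂ ψ₂ z := by
    intro z hz
    have h1 : DifferentiableAt ℂ (fun u : ℂ => (u - conj a)⁻¹) z := (differentiableAt_id.sub_const (conj a)).inv (sub_ne_zero.2 (hKa z hz))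
    have h2 : DifferentiableAt ℂ (fun u : ℂ => (u - conj b)⁻¹) z := (differentiableAt_id.sub_const (conj b)).inv (sub_ne_zero.2 (hKb z hz))
    have h3 : DifferentiableAt ℂ (fun u : ℂ => deriv h₂ u / h₂ u) z := ((differentiable_deriv hh₂d) z).div (hh₂d z) (hcof' z hz).1
    exact (h1.add h2).add h3
  have hψb : ∀ z ∈ closedBall a (‖w₀ - a‖ + r), ‖deriv ψ₂ z‖ ≤ S := fun z hz => (hcof' z hz).2
  have hS0 : 0 ≤ S := le_trans (norm_nonneg _) (hψb a ha_mem)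
  have hmvt : ∀ z ∈ closedBall a (‖w₀ - a‖ + r), ‖ψ₂ z - ψ₂ a‖ ≤ S * ‖z - a‖ := fun z hz =>
    (convex_closedBall a (‖w₀ - a‖ + r)).norm_image_sub_le_of_norm_deriv_le hψd hψb ha_mem hz
  -- non-vanishing bookkeeping on the closed Rouché ball
  have hsplit : ∀ z, ‖z - w₀‖ ≤ r → (z ≠ a ∧ z ≠ conj a) ∧ (z ≠ b ∧ z ≠ conj b) ∧ h z ≠ 0 ∧ h₂ z ≠ 0 := by
    intro z hz
    have hGz := hG0 z hz
    have hz1 : pairQ a.re a.im z ≠ 0 ∧ h z ≠ 0 := mul_ne_zero_iff.1 (by rw [← hfac z]; exact hGz)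
    have hz2 : pairQ b.re b.im z ≠ 0 ∧ h₂ z ≠ 0 := mul_ne_zero_iff.1 (by rw [← hfacb z]; exact hz1.2)
    exact ⟨ne_and_ne_conj_of_pairQ_ne_zero hz1.1, ne_and_ne_conj_of_pairQ_ne_zero hz2.1, hz1.2, hz2.2⟩
  have hlog : ∀ z, ‖z - w₀‖ ≤ r →
      deriv (iteratedDeriv j f) z / iteratedDeriv j f z = (z - a)⁻¹ + (z - b)⁻¹ + ψ₂ z := by
    intro z hz
    obtain ⟨⟨hza, hzac⟩, ⟨hzb, hzbc⟩, hhz, hh₂z⟩ := hsplit z hz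
    rw [logDeriv_eq_inv_add_psi hhd hfac hza hzac hhz, logDeriv_eq_inv_add_psi hh₂d hfacb hzb hzbc hh₂z]
    simp only [hψdef]
    ring
  -- the value at the top
  have hψa : ψ₂ a = c / 2 - (a - b)⁻¹ := by
    have hab : a ≠ b := fun e => hba e.symm
    have habc : a ≠ conj b := hKb a ha_mem
    have hKf : deriv h a / h a = (a - b)⁻¹ + ((a - conj b)⁻¹ + deriv h₂ a / h₂ a) :=
      logDeriv_eq_inv_add_psi hh₂d hfacb hab habc (hcof' a ha_mem).1
    exact psi2_apply_top hapos.ne' (by rw [hcdef]; exact hratio) hKf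
  -- §1 with `Π = (z − a)(z − b)`
  have hM : Differentiable ℂ (fun z : ℂ => (z - a) * (z - b)) := (differentiable_id.sub_const a).mul (differentiable_id.sub_const b)
  have hM0 : ∀ z, ‖z - w₀‖ < r → (z - a) * (z - b) ≠ 0 := by
    intro z hz
    obtain ⟨⟨hza, -⟩, ⟨hzb, -⟩, -, -⟩ := hsplit z hz.le
    exact mul_ne_zero (sub_ne_zero.2 hza) (sub_ne_zero.2 hzb)
  have hsm : ∀ z, ‖z - w₀‖ = r →
      ‖deriv (iteratedDeriv j f) z / iteratedDeriv j f z * ((z - a) * (z - b)) - d * (z - w₀)‖ < ‖d‖ * r := by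
    intro z hz
    obtain ⟨⟨hza, -⟩, ⟨hzb, -⟩, -, -⟩ := hsplit z hz.le
    rw [hlog z hz.le, twin_compare_eq (ψ₂ a) hza hzb]
    have h2 : ‖(ψ₂ z - ψ₂ a) * ((z - a) * (z - b))‖ ≤ S * ‖z - a‖ * ‖(z - a) * (z - b)‖ := by
      rw [norm_mul]
      exact mul_le_mul_of_nonneg_right (hmvt z (hmemK z hz.le)) (norm_nonneg _)
    have h3 := hsmall z hz
    rw [← hψa] at h3
    refine lt_of_le_of_lt (norm_add_le _ _) ?_
    linarith
  obtain ⟨u, hu, hu0⟩ := exists_crit_of_clusterCert hGd hM hd hr hG0 hM0 hsm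
  have hs1 : iteratedDeriv (j + 1) f = deriv (iteratedDeriv j f) := iteratedDeriv_succ
  obtain ⟨hn, hupos⟩ := nestedStep_of_near hu hball hup
  exact ⟨u, by rw [hs1]; exact hu0, hupos.ne', hn, hu⟩

/-- Row-level producer: a twin certificate at a zero `a` of `f^{(j)}` on a legal frame gives `TopPinning`ʼs first disjunct for `a`. -/
theorem pinning_of_twinCert {η : ℝ} {f : ℂ → ℂ} {x₀ s hmax R Hs : ℝ} {B : ℕ} (hE : EngineHyps5 2 η f x₀ s hmax R Hs B) {j : ℕ} {a : ℂ}
    (ha : iteratedDeriv j f a = 0) (hapos : 0 < a.im) (hN : NoTallerToucher f j a) {b w₀ d : ℂ} {r S : ℝ} (hT : TwinCert f j a b w₀ d r S) :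
    (∃ u : ℂ, iteratedDeriv (j + 1) f u = 0 ∧ u.im ≠ 0 ∧ NestedStep a u) ∨ (∃ x : ℝ, |x - a.re| ≤ a.im ∧ NLEventOf f j x) := by
  by_cases hda : iteratedDeriv (j + 1) f a = 0
  · exact Or.inl ⟨a, hda, hapos.ne', by show (a.re - a.re) ^ 2 + a.im ^ 2 ≤ a.im ^ 2; simp⟩
  obtain ⟨u, hu, hui, hn, -⟩ := exists_nestedChild_of_twinCert (realEntireLt2_of_hyps hE) j ha hapos hN hda hT
  exact Or.inl ⟨u, hu, hui, hn⟩

-- `k = 1` is part S: `RoucheCert`ʼs hypotheses (tree `exists_crit_near_linChild`, #1212) feed §1 with `M = z − a`, `d = c/2`, `w₀ = a − 2/c`.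
-- Consistency check only — an unnamed `example`, so nothing is re-landed under a new name (desk g31 l.8529).
example {G : ℂ → ℂ} (hG : Differentiable ℂ G) {a c : ℂ} (hc : c ≠ 0) {r : ℝ} (hr : 0 < r)
    (hr2 : r < ‖2 / c‖) (hG0 : ∀ z, ‖z - (a - 2 / c)‖ ≤ r → G z ≠ 0)
    (hsmall : ∀ z, ‖z - (a - 2 / c)‖ = r → ‖(deriv G z / G z - (z - a)⁻¹ - c / 2) * (z - a)‖ < ‖c‖ / 2 * r) :
    ∃ u : ℂ, ‖u - (a - 2 / c)‖ < r ∧ deriv G u = 0 := by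
  have hc2 : c / 2 ≠ 0 := div_ne_zero hc two_ne_zero
  have hne_a : ∀ z, ‖z - (a - 2 / c)‖ ≤ r → z ≠ a := by
    intro z hz e
    rw [e, show a - (a - 2 / c) = 2 / c by ring] at hz
    linarith
  refine exists_crit_of_clusterCert (M := fun z => z - a) hG (differentiable_id.sub_const a) hc2 hr hG0
    (fun z hz => sub_ne_zero.2 (hne_a z hz.le)) ?_
  intro z hz
  have hza : z - a ≠ 0 := sub_ne_zero.2 (hne_a z hz.le)
  have e : deriv G z / G z * (z - a) - c / 2 * (z - (a - 2 / c)) = (deriv G z / G z - (z - a)⁻¹ - c / 2) * (z - a) := by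
    field_simp
    ring
  rw [e, norm_div, Complex.norm_two]
  exact hsmall z hz

end RhW08.Lens1ArcSign
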